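import Literature.NumberTheory.GaloisRepresentations.SerreCartanNormalizerGL2Fp
import HarnessLib

/-!
# Caraiani–Newton, Lemma 7.1.1: irreducible subgroups of `GL₂(𝔽_p)` whose determinant-one
# part is absolutely reducible normalise a Cartan subgroup (and its `p = 3`, `p = 5` refinements)

Topic `NumberTheory/GaloisRepresentations`; theorems only (no definitions, no named facts), on the
vocabulary of Serre 1972 §2 as formalised in `SerreCartanSubgroupsGL2Fp{,Proofs}`,
`SerreCartanNormalizerGL2Fp` (`Serre1972.cartanSubgroups`, `splitCartan P`, `unitGroup k`,
`adjoinElem y`, `(N : C) = 2`), `SerreSubgroupsGL2Fp` (Prop. 15) and `ProjectiveType`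
(`eigenvectorStabilizer v hv`, the Borel subgroup of the line `F v`).

A. Caraiani, J. Newton, *On the modularity of elliptic curves over imaginary quadratic fields*,
arXiv:2301.10509 [CaraianiNewton2023], §7.1, p. 92:

> **Lemma 7.1.1.** Let `F` be a number field and `ρ̄ : G_F → GL₂(𝔽_p)` an irreducible
> representation with determinant `ε̄_p` and `ρ̄|_{G_{F(ζ_p)}}` absolutely reducible.
> (1) `ρ̄(G_F)` is a subgroup of the normalizer of a Cartan subgroup.
> (2) If `p = 3`, `ρ̄(G_F)` is conjugate to `C_s⁺(3)` (the normalizer of a split Cartan subgroup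
> of `GL₂(𝔽₃)`) or to a subgroup of `C_ns(3)` (a non-split Cartan).
> (3) If `p = 5` and `[F(ζ₅) : F] = 4`, then `ρ̄(G_F)` is conjugate to a subgroup of `C_ns⁺(5)`
> (the normalizer of a non-split Cartan).

This is the lemma through which Thm. 7.1 of the source (modularity of `E/F`, `F` imaginary
quadratic, under conditions on `E[3]`, `E[5]`) is reduced from Cor. 6.1.1 to quadratic points
on four modular curves; it is one of the ingredients of the tree's named fact
`Literature.NumberTheory.Automorphic.CaraianiNewton2023_modularity` (Thm. 1.1 = Cor. 7.1.2),
cf. `Literature.NumberTheory.Automorphic.CaraianiNewtonModularityProofs`.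

## The group-theoretic content, and what is proved

Since `det ρ̄ = ε̄_p`, `G_{F(ζ_p)} = ker ε̄_p|_{G_F}` and `ρ̄(G_{F(ζ_p)}) = G ∩ SL₂(𝔽_p)` for
`G = ρ̄(G_F)` (source, proof: "We have `G' = G ∩ SL₂(𝔽_p) = ρ̄(G_{F(ζ_p)})`"), and
`[F(ζ₅) : F] = 4` says `det G = 𝔽₅ˣ`.  The statements proved here are about a subgroup
`G ⊆ GL₂(𝔽_p)` with

* `hirr` : `G` fixes no line of `𝔽_p²` (`∀ v ≠ 0, ¬ G ≤ eigenvectorStabilizer v hv`) —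
  "`ρ̄` irreducible";
* `hred` : there are a field `L`, `f : 𝔽_p →+* L` and `0 ≠ v ∈ L²` with `f(g) v ∈ L v` for every
  `g ∈ G` of determinant `1` — "`ρ̄|_{G_{F(ζ_p)}}` absolutely reducible" (a common eigenvector of
  `G ∩ SL₂(𝔽_p)` after some extension of scalars);

namely (all `[cite: CaraianiNewton2023, Lemma 7.1.1]`):

* `CaraianiNewton.exists_le_normalizer_cartan` — **(1)** for `p` odd: `G ≤ N(C)` for some
  `C ∈ Serre1972.cartanSubgroups (ZMod p)`;
* `CaraianiNewton.eq_normalizer_splitCartan_or_le_unitGroup` — **(2)**, `p = 3`: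
  `G = N(P (* 0; 0 *) P⁻¹)` for some `P` (so `G` *is* a `C_s⁺(3)`, of order `8`), or `G ≤ kˣ` for a
  field `k ⊆ M₂(𝔽₃)` of degree `2` (a `C_ns(3)`);
* `CaraianiNewton.exists_le_normalizer_nonsplitCartan` — **(3)**, `p = 5`, `det G = 𝔽₅ˣ`:
  `G ≤ N(kˣ)` for a field `k ⊆ M₂(𝔽₅)` of degree `2` (a `C_ns⁺(5)`);

together with the group-theoretic step of the proof of **Lemma 6.2.2** of the source
(`not_dvd_card_or_ker_det_le`: an irreducible `H ⊆ GL₂(𝔽_p)` has order prime to `p` or contains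
`SL₂(𝔽_p)`, by Serre's Prop. 15; `exists_projective_ne_one_not_dvd_orderOf`: hence contains an
element with non-identity image in `PGL₂(𝔽_p)` of order prime to `p`).  The passage from a
homomorphism `ρ̄ : Γ → GL₂(𝔽_p)` with Mathlib-irreducible `glRepresentation ρ̄` and
`¬ IsAbsIrreducible (ρ̄|_{ker det ρ̄})` to these hypotheses on `G = ρ̄(Γ)` is recorded separately
(it needs the residual-representation vocabulary of `ResidualGaloisRep`).

## Proofs

The source proves (1) by appeal to [FLHS15, Lemma 2.2] and (3) via [FLHS15, Prop. 4.1]; the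
proofs here are self-contained on Serre's §2 (each theorem's docstring has the details):

* `trace_commutator_eq_two`, `mul_comm_of_det_eq_one`: a commutator of two elements with a
  common eigenvector `v` fixes `v`, so has trace `2`; with determinant `1` it is `1 + N`, `N² = 0`,
  i.e. trivial or of order `p`;
* `not_dvd_card`: `p ∤ |G|` — by Prop. 15, `p ∣ |G|` would give a `G`-stable line or
  `G ⊇ SL₂(𝔽_p)`, whose elementary transvections have no common eigenvector over any field
  (`eq_zero_of_transvections_mulVec_eq_smul`); hence `G ∩ SL₂(𝔽_p)` is abelian;
* `exists_le_unitGroup_adjoinElem_of_comm` (any field): an abelian irreducible `G` lies in the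
  non-split Cartan subgroup `F[y]ˣ` of any of its non-scalar elements;
* `exists_det_eq_one_ne_smul_one`, `le_normalizer_unitGroup_adjoinElem_of_det_eq_one`: for
  `G` non-abelian a non-scalar `s` of determinant `1` exists and `G` normalises `𝔽_p[s]ˣ`
  (every conjugate of `s` commutes with `s`), a Cartan subgroup for `p` odd (`disc_ne_zero`);
* `p = 3`: `tr s = 0`, `s² = -1`, elements outside `𝔽₃[s]ˣ` are involutions of determinant
  `-1` anticommuting with `s`, and `G` is the monomial group of the eigenbasis of one of them;
* `p = 5`: if `𝔽₅[s]` splits, `s ~ diag(2, 3)`; antidiagonal elements (in the eigenbasis of `s`)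
  have determinant `≠ 1`, diagonal ones have `det² = 1`, an element `g₀` of determinant `2` is
  antidiagonal with `g₀² = 3`, a non-square, and `G ≤ N(𝔽₅[g₀]ˣ)`.

## References

* [CaraianiNewton2023] A. Caraiani, J. Newton, *On the modularity of elliptic curves over
  imaginary quadratic fields*, arXiv:2301.10509v3, §6.2 (Lemma 6.2.2 and its proof, pp. 90–91),
  §7.1 (Thm. 7.1, Lemma 7.1.1 and its proof, p. 92) (read 2026-08-15 from the arXiv text,
  `lit read arxiv:2301.10509`).
* [Serre1972] J.-P. Serre, *Propriétés galoisiennes des points d'ordre fini des courbes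
  elliptiques*, Invent. Math. 15 (1972), §2.1–2.4 (Cartan subgroups, normalisers, Prop. 15) —
  through the tree files cited above.
* [FreitasLeHungSiksek2015] N. Freitas, B. V. Le Hung, S. Siksek, *Elliptic curves over real
  quadratic fields are modular*, Invent. Math. 201 (2015), Lemma 2.2, Prop. 4.1 (the source's
  references for (1) and (3); not used here).
-/

open Matrix
open scoped MatrixGroups

namespace Literature.NumberTheory.GaloisRepresentations.CaraianiNewton

universe u

section Field

variable {F : Type*} [Field F]

/-- `(c - 1)² = 0` for a `2 × 2` matrix with `tr c = 2` and `det c = 1` (Cayley–Hamilton).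
[folklore] -/
theorem sub_one_mul_sub_one_eq_zero {c : Matrix (Fin 2) (Fin 2) F} (htr : c.trace = 2) (hdet : c.det = 1) :
    (c - 1) * (c - 1) = 0 := by
  have h := DeligneSerre1974.TwoByTwo.mul_self_eq c
  rw [htr, hdet, one_smul, two_smul] at h
  rw [sub_mul, mul_sub, mul_one, one_mul, h]
  abel

/-- If `v ≠ 0` is a common eigenvector, after extension of scalars along `f : F →+* L`, of two
elements `g, h ∈ GL₂(F)`, then their commutator `g h g⁻¹ h⁻¹` fixes `v` and hence has trace `2`
(its determinant being `1`). [folklore] -/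
theorem trace_commutator_eq_two {L : Type*} [Field L] (f : F →+* L) {g h : GL (Fin 2) F}
    {v : Fin 2 → L} (hv : v ≠ 0) {a b : L}
    (hg : ((g : Matrix (Fin 2) (Fin 2) F).map f) *ᵥ v = a • v) (hh : ((h : Matrix (Fin 2) (Fin 2) F).map f) *ᵥ v = b • v) :
    ((g * h * g⁻¹ * h⁻¹ : GL (Fin 2) F) : Matrix (Fin 2) (Fin 2) F).trace = 2 := by
  set c : GL (Fin 2) F := g * h * g⁻¹ * h⁻¹ with hc
  set gL : GL (Fin 2) L := Matrix.GeneralLinearGroup.map f g with hgL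
  set hL : GL (Fin 2) L := Matrix.GeneralLinearGroup.map f h with hhL
  set cL : GL (Fin 2) L := Matrix.GeneralLinearGroup.map f c with hcL
  have hcL' : cL = gL * hL * gL⁻¹ * hL⁻¹ := by
    simp only [hcL, hc, hgL, hhL, map_mul, map_inv]
  have hgv : (gL : Matrix (Fin 2) (Fin 2) L) *ᵥ v = a • v := hg
  have hhv : (hL : Matrix (Fin 2) (Fin 2) L) *ᵥ v = b • v := hh
  -- `a ≠ 0` and `b ≠ 0`
  have ha : a ≠ 0 := by
    rintro rfl
    apply hv
    rw [zero_smul] at hgv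
    have : ((gL⁻¹ * gL : GL (Fin 2) L) : Matrix (Fin 2) (Fin 2) L) *ᵥ v = 0 := by
      rw [Units.val_mul, ← mulVec_mulVec, hgv, mulVec_zero]
    rwa [inv_mul_cancel, Units.val_one, one_mulVec] at this
  have hb : b ≠ 0 := by
    rintro rfl
    apply hv
    rw [zero_smul] at hhv
    have : ((hL⁻¹ * hL : GL (Fin 2) L) : Matrix (Fin 2) (Fin 2) L) *ᵥ v = 0 := by
      rw [Units.val_mul, ← mulVec_mulVec, hhv, mulVec_zero]
    rwa [inv_mul_cancel, Units.val_one, one_mulVec] at this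
  -- `cL (h g v) = g h v`, i.e. `(ab) cL v = (ab) v`
  have key : (cL : Matrix (Fin 2) (Fin 2) L) *ᵥ ((a * b) • v) = (a * b) • v := by
    have h1 : ((hL * gL : GL (Fin 2) L) : Matrix (Fin 2) (Fin 2) L) *ᵥ v = (a * b) • v := by
      rw [Units.val_mul, ← mulVec_mulVec, hgv, mulVec_smul, hhv, smul_smul]
    have h2 : ((gL * hL : GL (Fin 2) L) : Matrix (Fin 2) (Fin 2) L) *ᵥ v = (a * b) • v := by
      rw [Units.val_mul, ← mulVec_mulVec, hhv, mulVec_smul, hgv, smul_smul, mul_comm]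
    have h3 : cL * (hL * gL) = gL * hL := by rw [hcL']; group
    calc (cL : Matrix (Fin 2) (Fin 2) L) *ᵥ ((a * b) • v)
        = (cL : Matrix (Fin 2) (Fin 2) L) *ᵥ
            (((hL * gL : GL (Fin 2) L) : Matrix (Fin 2) (Fin 2) L) *ᵥ v) := by rw [h1]
      _ = ((cL * (hL * gL) : GL (Fin 2) L) : Matrix (Fin 2) (Fin 2) L) *ᵥ v := by
          rw [mulVec_mulVec, ← Units.val_mul]
      _ = (a * b) • v := by rw [h3, h2]
  have hcv : (cL : Matrix (Fin 2) (Fin 2) L) *ᵥ v = (1 : L) • v := by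
    rw [mulVec_smul] at key
    rw [one_smul]
    exact smul_right_injective _ (mul_ne_zero ha hb) key
  -- so `1` is an eigenvalue of `cL`: `1 - tr cL + det cL = 0`, and `det cL = 1`
  have hchar := Serre1972.sq_sub_trace_mul_add_det_eq_zero hv hcv
  have hdetc : (c : Matrix (Fin 2) (Fin 2) F).det = 1 := by
    rw [← Matrix.GeneralLinearGroup.val_det_apply, hc, map_mul, map_mul, map_mul, map_inv,
      map_inv, mul_right_comm (Matrix.GeneralLinearGroup.det g), mul_inv_cancel, one_mul,
      mul_inv_cancel, Units.val_one]
  have hdetcL : (cL : Matrix (Fin 2) (Fin 2) L).det = 1 := by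
    rw [hcL, Matrix.GeneralLinearGroup.val_map_apply, ← RingHom.mapMatrix_apply, ← RingHom.map_det,
      hdetc, map_one]
  have htrcL : (cL : Matrix (Fin 2) (Fin 2) L).trace = 2 := by
    rw [hdetcL] at hchar
    linear_combination -hchar
  have htr : f ((c : Matrix (Fin 2) (Fin 2) F).trace) = f 2 := by
    rw [AddMonoidHom.map_trace, map_ofNat]
    exact htrcL
  exact f.injective htr

/-- The two elementary transvections `(1 1; 0 1)` and `(1 0; 1 1)` have no common eigenvector
over any field: `SL₂` acts absolutely irreducibly on the plane. [folklore] -/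
theorem eq_zero_of_transvections_mulVec_eq_smul {L : Type*} [Field L] {v : Fin 2 → L} {a b : L}
    (h₁ : (!![1, 1; 0, 1] : Matrix (Fin 2) (Fin 2) L) *ᵥ v = a • v)
    (h₂ : (!![1, 0; 1, 1] : Matrix (Fin 2) (Fin 2) L) *ᵥ v = b • v) : v = 0 := by
  have e₁ := congrFun h₁ 0
  have e₂ := congrFun h₁ 1
  have e₃ := congrFun h₂ 0
  have e₄ := congrFun h₂ 1
  simp [Matrix.mulVec, dotProduct, Fin.sum_univ_two] at e₁ e₂ e₃ e₄
  -- e₁ : v 0 + v 1 = a * v 0, e₂ : v 1 = a * v 1, e₃ : v 0 = b * v 0, e₄ : v 0 + v 1 = b * v 1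
  have hv1 : v 1 = 0 := by
    by_contra h1
    have ha : a = 1 := by
      have : (a - 1) * v 1 = 0 := by linear_combination -e₂
      have := (mul_eq_zero.mp this).resolve_right h1
      linear_combination this
    apply h1
    linear_combination e₁ + (v 0) * ha
  have hv0 : v 0 = 0 := by linear_combination e₄ - hv1 + b * hv1
  ext i
  fin_cases i
  · exact hv0
  · exact hv1

/-- **From conjugates in `F[s]` to the normaliser of `F[s]ˣ`.** If every `G`-conjugate of a
non-scalar `s ∈ GL₂(F)` lies in the algebra `F[s]`, then `G` normalises the group `F[s]ˣ`
(for `k ∈ G`, `F[k s k⁻¹] = F[s]` as `k s k⁻¹ ∈ F[s]` is non-scalar, and `k F[s] k⁻¹ = F[k s k⁻¹]`);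
cf. `Serre1972.le_normalizer_unitGroup_adjoinElem`. [folklore] -/
theorem le_normalizer_unitGroup_adjoinElem_of_conj_mem {G : Subgroup (GL (Fin 2) F)}
    {s : GL (Fin 2) F} (hss : ∀ c : F, (s : Matrix (Fin 2) (Fin 2) F) ≠ c • 1)
    (hconj : ∀ k ∈ G, ((k * s * k⁻¹ : GL (Fin 2) F) : Matrix (Fin 2) (Fin 2) F) ∈ Serre1972.adjoinElem (s : Matrix (Fin 2) (Fin 2) F)) :
    G ≤ Subgroup.normalizer
      (Serre1972.unitGroup (Serre1972.adjoinElem (s : Matrix (Fin 2) (Fin 2) F)) : Set (GL (Fin 2) F)) := by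
  -- `F[k s k⁻¹] = F[s]` for `k ∈ G`
  have key : ∀ k ∈ G,
      Serre1972.adjoinElem ((k : Matrix (Fin 2) (Fin 2) F) * (s : Matrix (Fin 2) (Fin 2) F) * (k : Matrix (Fin 2) (Fin 2) F)⁻¹) =
        Serre1972.adjoinElem (s : Matrix (Fin 2) (Fin 2) F) := by
    intro k hk
    have hmat : ((k * s * k⁻¹ : GL (Fin 2) F) : Matrix (Fin 2) (Fin 2) F) = (k : Matrix (Fin 2) (Fin 2) F) * (s : Matrix (Fin 2) (Fin 2) F) * (k : Matrix (Fin 2) (Fin 2) F)⁻¹ := by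
      simp only [Units.val_mul, Matrix.coe_units_inv]
    have hku : IsUnit (k : Matrix (Fin 2) (Fin 2) F).det := (GL2.det_ne_zero k).isUnit
    have hns : ∀ c : F, (k : Matrix (Fin 2) (Fin 2) F) * (s : Matrix (Fin 2) (Fin 2) F) * (k : Matrix (Fin 2) (Fin 2) F)⁻¹ ≠ c • 1 := by
      intro c hc
      apply hss c
      calc (s : Matrix (Fin 2) (Fin 2) F) = (k : Matrix (Fin 2) (Fin 2) F)⁻¹ * ((k : Matrix (Fin 2) (Fin 2) F) * (s : Matrix (Fin 2) (Fin 2) F) * (k : Matrix (Fin 2) (Fin 2) F)⁻¹) * k :=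
            (Serre1972.conj_cancel' _ hku _).symm
        _ = c • 1 := by
            rw [hc, Matrix.mul_smul, Matrix.mul_one, Matrix.smul_mul, Matrix.nonsing_inv_mul _ hku]
    rw [← hmat] at hns ⊢
    exact Serre1972.adjoinElem_eq_of_mem (hconj k hk) hns
  intro g hg
  rw [Subgroup.mem_normalizer_iff]
  have hgu : IsUnit (g : Matrix (Fin 2) (Fin 2) F).det := (GL2.det_ne_zero g).isUnit
  intro h
  simp only [Serre1972.mem_unitGroup_iff, Units.val_mul, Matrix.coe_units_inv]
  constructor
  · intro hh
    have := Serre1972.conj_mem_adjoinElem hh (Matrix.mul_nonsing_inv _ hgu)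
    rwa [key g hg] at this
  · intro hh
    have := Serre1972.conj_mem_adjoinElem hh (Matrix.nonsing_inv_mul _ hgu)
    rw [Serre1972.conj_cancel' _ hgu] at this
    have key' := key g⁻¹ (G.inv_mem hg)
    simp only [Matrix.coe_units_inv, Matrix.nonsing_inv_nonsing_inv _ hgu] at key'
    rwa [key'] at this

end Field

/-! ### Conjugation bookkeeping in `GL₂(F)` -/

section Conj

variable {F : Type*} [Field F]

/-- `P⁻¹ (x y) P = (P⁻¹ x P)(P⁻¹ y P)`. [folklore] -/
theorem conj_mul (P x y : GL (Fin 2) F) :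
    (P⁻¹ * (x * y) * P : GL (Fin 2) F) = (P⁻¹ * x * P) * (P⁻¹ * y * P) := by
  group

/-- Conjugation by `P` is injective (on matrices of `GL₂`). [folklore] -/
theorem eq_of_coe_conj_eq {P x y : GL (Fin 2) F}
    (hxy : ((P⁻¹ * x * P : GL (Fin 2) F) : Matrix (Fin 2) (Fin 2) F) = ((P⁻¹ * y * P : GL (Fin 2) F) : Matrix (Fin 2) (Fin 2) F)) :
    x = y := by
  have h := Units.ext (α := Matrix (Fin 2) (Fin 2) F) hxy
  calc x = P * (P⁻¹ * x * P) * P⁻¹ := by group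
    _ = P * (P⁻¹ * y * P) * P⁻¹ := by rw [h]
    _ = y := by group

/-- `P⁻¹ (-x) P = -(P⁻¹ x P)`. [folklore] -/
theorem coe_conj_neg (P x : GL (Fin 2) F) :
    ((P⁻¹ * -x * P : GL (Fin 2) F) : Matrix (Fin 2) (Fin 2) F) = -((P⁻¹ * x * P : GL (Fin 2) F) : Matrix (Fin 2) (Fin 2) F) := by
  simp only [Units.val_mul, Units.val_neg, Matrix.mul_neg, Matrix.neg_mul]

/-- `P⁻¹ (b y) P = b (P⁻¹ y P)`. [folklore] -/
theorem coe_conj_of_eq_smul {P x : GL (Fin 2) F} {b : F} {y : Matrix (Fin 2) (Fin 2) F} (hx : (x : Matrix (Fin 2) (Fin 2) F) = b • y) :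
    ((P⁻¹ * x * P : GL (Fin 2) F) : Matrix (Fin 2) (Fin 2) F) = b • ((P : Matrix (Fin 2) (Fin 2) F)⁻¹ * y * P) := by
  simp only [Units.val_mul, Matrix.coe_units_inv, hx, Matrix.mul_smul, Matrix.smul_mul]

/-- Conjugation preserves the trace. [folklore] -/
theorem trace_coe_conj (P x : GL (Fin 2) F) :
    ((P⁻¹ * x * P : GL (Fin 2) F) : Matrix (Fin 2) (Fin 2) F).trace = (x : Matrix (Fin 2) (Fin 2) F).trace := by
  rw [Units.val_mul, Units.val_mul, Matrix.trace_mul_cycle, ← Units.val_mul, mul_inv_cancel,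
    Units.val_one, Matrix.one_mul]

/-- Conjugation preserves the determinant. [folklore] -/
theorem det_coe_conj (P x : GL (Fin 2) F) :
    ((P⁻¹ * x * P : GL (Fin 2) F) : Matrix (Fin 2) (Fin 2) F).det = (x : Matrix (Fin 2) (Fin 2) F).det := by
  rw [← Matrix.GeneralLinearGroup.val_det_apply, ← Matrix.GeneralLinearGroup.val_det_apply,
    map_mul, map_mul, map_inv, mul_right_comm, inv_mul_cancel, one_mul]

/-- Undoing a conjugation: `x = P (P⁻¹ x P) P⁻¹` on matrices. [folklore] -/
theorem coe_eq_conj_conj (P x : GL (Fin 2) F) :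
    (x : Matrix (Fin 2) (Fin 2) F) = (P : Matrix (Fin 2) (Fin 2) F) * ((P⁻¹ * x * P : GL (Fin 2) F) : Matrix (Fin 2) (Fin 2) F) * (P : Matrix (Fin 2) (Fin 2) F)⁻¹ := by
  rw [Units.val_mul, Units.val_mul, Matrix.coe_units_inv,
    Serre1972.conj_cancel _ (GL2.det_ne_zero P).isUnit]

/-- The first column of an invertible `2 × 2` matrix is non-zero. [folklore] -/
theorem col_zero_ne_zero (P : GL (Fin 2) F) : (P : Matrix (Fin 2) (Fin 2) F).col 0 ≠ 0 := by
  intro h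
  apply GL2.det_ne_zero P
  have h0 : (P : Matrix (Fin 2) (Fin 2) F) 0 0 = 0 := by simpa using congrFun h 0
  have h1 : (P : Matrix (Fin 2) (Fin 2) F) 1 0 = 0 := by simpa using congrFun h 1
  rw [Matrix.det_fin_two, h0, h1]; ring

end Conj

/-! ### Over `𝔽_p` -/

section Prime

variable {p : ℕ} [Fact p.Prime]

/-- The upper elementary transvection `(1 1; 0 1)` is invertible. [folklore] -/
private theorem det_upper_ne_zero : (!![1, 1; 0, 1] : Matrix (Fin 2) (Fin 2) (ZMod p)).det ≠ 0 := by
  simp [Matrix.det_fin_two_of]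

/-- The lower elementary transvection `(1 0; 1 1)` is invertible. [folklore] -/
private theorem det_lower_ne_zero : (!![1, 0; 1, 1] : Matrix (Fin 2) (Fin 2) (ZMod p)).det ≠ 0 := by
  simp [Matrix.det_fin_two_of]

/-- **Step (b) of the proof of Lemma 7.1.1 (1): `p ∤ |G|`.** If `G ⊆ GL₂(𝔽_p)` has no
`G`-stable line in `𝔽_p²` while its determinant-one part `G ∩ SL₂(𝔽_p)` has a common eigenvector
over some extension field, then `p` does not divide `|G|`: otherwise, by Serre's Prop. 15
(`Serre1972.ker_det_le_or_exists_eigenvector_of_dvd_card`), either `G` fixes a line, or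
`G ⊇ SL₂(𝔽_p)`, whose two elementary transvections have no common eigenvector over any field.
[cite: CaraianiNewton2023, Lemma 7.1.1 (proof)] -/
theorem not_dvd_card (G : Subgroup (GL (Fin 2) (ZMod p)))
    (hirr : ∀ (v : Fin 2 → ZMod p) (hv : v ≠ 0), ¬ G ≤ eigenvectorStabilizer v hv)
    (hred : ∃ (L : Type u) (_ : Field L) (f : ZMod p →+* L) (v : Fin 2 → L), v ≠ 0 ∧
      ∀ g ∈ G, Matrix.GeneralLinearGroup.det g = 1 → ∃ c : L, ((g : Matrix (Fin 2) (Fin 2) (ZMod p)).map f) *ᵥ v = c • v) :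
    ¬ p ∣ Nat.card G := by
  intro hpG
  rcases Serre1972.ker_det_le_or_exists_eigenvector_of_dvd_card G hpG with hSL | ⟨v, hv, hGv⟩
  · obtain ⟨L, _, f, v, hv, hG⟩ := hred
    set x : GL (Fin 2) (ZMod p) := Matrix.GeneralLinearGroup.mkOfDetNeZero _ det_upper_ne_zero
      with hx
    set y : GL (Fin 2) (ZMod p) := Matrix.GeneralLinearGroup.mkOfDetNeZero _ det_lower_ne_zero
      with hy
    have hxdet : Matrix.GeneralLinearGroup.det x = 1 := by
      ext
      rw [Matrix.GeneralLinearGroup.val_det_apply, hx, Units.val_one]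
      simp [Matrix.GeneralLinearGroup.mkOfDetNeZero, Matrix.det_fin_two_of]
    have hydet : Matrix.GeneralLinearGroup.det y = 1 := by
      ext
      rw [Matrix.GeneralLinearGroup.val_det_apply, hy, Units.val_one]
      simp [Matrix.GeneralLinearGroup.mkOfDetNeZero, Matrix.det_fin_two_of]
    have hxG : x ∈ G := hSL (by rw [MonoidHom.mem_ker]; exact hxdet)
    have hyG : y ∈ G := hSL (by rw [MonoidHom.mem_ker]; exact hydet)
    obtain ⟨a, ha⟩ := hG x hxG hxdet
    obtain ⟨b, hb⟩ := hG y hyG hydet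
    have hxcoe : (x : Matrix (Fin 2) (Fin 2) (ZMod p)) = !![1, 1; 0, 1] := rfl
    have hycoe : (y : Matrix (Fin 2) (Fin 2) (ZMod p)) = !![1, 0; 1, 1] := rfl
    rw [hxcoe] at ha
    rw [hycoe] at hb
    have hmap₁ : (!![1, 1; 0, 1] : Matrix (Fin 2) (Fin 2) (ZMod p)).map f = !![1, 1; 0, 1] := by
      ext i j; fin_cases i <;> fin_cases j <;> simp
    have hmap₂ : (!![1, 0; 1, 1] : Matrix (Fin 2) (Fin 2) (ZMod p)).map f = !![1, 0; 1, 1] := by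
      ext i j; fin_cases i <;> fin_cases j <;> simp
    rw [hmap₁] at ha
    rw [hmap₂] at hb
    exact hv (eq_zero_of_transvections_mulVec_eq_smul ha hb)
  · exact hirr v hv fun g hg ↦ mem_eigenvectorStabilizer_iff.mpr (hGv g hg)

/-- **Step (c): the determinant-one part is abelian.** Under the hypotheses of `not_dvd_card`,
any two elements of `G` of determinant `1` commute: their commutator `c` has `tr c = 2`,
`det c = 1`, so `c = 1 + N` with `N² = 0`, and `N ≠ 0` would make `c` an element of order `p`
of `G`. [cite: CaraianiNewton2023, Lemma 7.1.1 (proof)] -/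
theorem mul_comm_of_det_eq_one (G : Subgroup (GL (Fin 2) (ZMod p)))
    (hirr : ∀ (v : Fin 2 → ZMod p) (hv : v ≠ 0), ¬ G ≤ eigenvectorStabilizer v hv)
    (hred : ∃ (L : Type u) (_ : Field L) (f : ZMod p →+* L) (v : Fin 2 → L), v ≠ 0 ∧
      ∀ g ∈ G, Matrix.GeneralLinearGroup.det g = 1 → ∃ c : L, ((g : Matrix (Fin 2) (Fin 2) (ZMod p)).map f) *ᵥ v = c • v)
    {g h : GL (Fin 2) (ZMod p)} (hg : g ∈ G) (hh : h ∈ G)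
    (hgdet : Matrix.GeneralLinearGroup.det g = 1) (hhdet : Matrix.GeneralLinearGroup.det h = 1) :
    g * h = h * g := by
  have hpG := not_dvd_card G hirr hred
  obtain ⟨L, _, f, v, hv, hG⟩ := hred
  obtain ⟨a, ha⟩ := hG g hg hgdet
  obtain ⟨b, hb⟩ := hG h hh hhdet
  set c : GL (Fin 2) (ZMod p) := g * h * g⁻¹ * h⁻¹ with hc
  have hcG : c ∈ G := G.mul_mem (G.mul_mem (G.mul_mem hg hh) (G.inv_mem hg)) (G.inv_mem hh)
  have htr : (c : Matrix (Fin 2) (Fin 2) (ZMod p)).trace = 2 := trace_commutator_eq_two f hv ha hb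
  have hdet : (c : Matrix (Fin 2) (Fin 2) (ZMod p)).det = 1 := by
    rw [← Matrix.GeneralLinearGroup.val_det_apply, hc, map_mul, map_mul, map_mul, map_inv,
      map_inv, mul_right_comm (Matrix.GeneralLinearGroup.det g), mul_inv_cancel, one_mul,
      mul_inv_cancel, Units.val_one]
  set N : Matrix (Fin 2) (Fin 2) (ZMod p) := (c : Matrix (Fin 2) (Fin 2) (ZMod p)) - 1 with hN
  have hNN : N * N = 0 := sub_one_mul_sub_one_eq_zero htr hdet
  by_cases hN0 : N = 0
  · have hc1 : c = 1 := Units.ext (sub_eq_zero.mp hN0)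
    rw [hc] at hc1
    calc g * h = g * h * g⁻¹ * h⁻¹ * (h * g) := by group
      _ = h * g := by rw [hc1, one_mul]
  · exfalso
    apply hpG
    have hcN : (c : Matrix (Fin 2) (Fin 2) (ZMod p)) = 1 + N := by rw [hN]; abel
    have hcp : c ^ p = 1 := by
      apply Units.ext
      rw [Units.val_pow_eq_pow_val, hcN, DeligneSerre1974.one_add_pow_of_mul_self_eq_zero hNN p,
        ZMod.natCast_self, zero_smul, add_zero, Units.val_one]
    have hc1 : c ≠ 1 := by
      intro h1
      apply hN0
      rw [hN, h1, Units.val_one, sub_self]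
    have hord : orderOf c = p := orderOf_eq_prime hcp hc1
    have hdvd := G.orderOf_dvd_natCard hcG
    rwa [hord] at hdvd

/-- **Irreducible groups contain non-scalar elements**: if `G ⊆ GL₂(F)` fixes no line then some
element of `G` is not a scalar matrix (scalars fix every line). [folklore] -/
theorem exists_mem_ne_smul_one {F : Type*} [Field F] (G : Subgroup (GL (Fin 2) F))
    (hirr : ∀ (v : Fin 2 → F) (hv : v ≠ 0), ¬ G ≤ eigenvectorStabilizer v hv) :
    ∃ y ∈ G, ∀ c : F, (y : Matrix (Fin 2) (Fin 2) F) ≠ c • 1 := by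
  by_contra! hall
  refine hirr (Pi.single 0 1) (by simp) fun g hg ↦ ?_
  obtain ⟨c, hc⟩ := hall g hg
  exact mem_eigenvectorStabilizer_iff.mpr ⟨c, by rw [hc, Matrix.smul_mulVec, Matrix.one_mulVec]⟩

/-- **Abelian irreducible subgroups of `GL₂(F)` lie in non-split Cartan subgroups** (any field
`F`): if `G` is abelian and fixes no line of `F²`, then for any non-scalar `y ∈ G` (they exist,
`exists_mem_ne_smul_one`) the characteristic polynomial `X² - tr(y) X + det(y)` has no root in
`F` — so that `F[y]` is a field of degree `2` (`Serre1972.isField_adjoinElem`,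
`Serre1972.finrank_adjoinElem`) — and `G ⊆ F[y]ˣ`: indeed `G ⊆ F[y]ˣ` by commutativity
(`Serre1972.le_unitGroup_adjoinElem_of_comm`), and an eigenvector of `y` in `F²` would be an
eigenvector of every `a + b y ∈ G`.  (In the source: "if `G` acts absolutely reducibly … it is
a subgroup of a Cartan subgroup"; "`G` is absolutely reducible, hence a subgroup of a non-split
Cartan".) [cite: CaraianiNewton2023, Lemma 7.1.1 (proof)] -/
theorem exists_le_unitGroup_adjoinElem_of_comm {F : Type*} [Field F]
    (G : Subgroup (GL (Fin 2) F))
    (hirr : ∀ (v : Fin 2 → F) (hv : v ≠ 0), ¬ G ≤ eigenvectorStabilizer v hv)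
    (hab : ∀ a b : G, a * b = b * a) :
    ∃ y ∈ G, (∀ c : F, (y : Matrix (Fin 2) (Fin 2) F) ≠ c • 1) ∧
      (∀ l : F, l ^ 2 - (y : Matrix (Fin 2) (Fin 2) F).trace * l +
        (y : Matrix (Fin 2) (Fin 2) F).det ≠ 0) ∧
      G ≤ Serre1972.unitGroup (Serre1972.adjoinElem (y : Matrix (Fin 2) (Fin 2) F)) := by
  obtain ⟨y, hyG, hys⟩ := exists_mem_ne_smul_one G hirr
  have hle : G ≤ Serre1972.unitGroup (Serre1972.adjoinElem (y : Matrix (Fin 2) (Fin 2) F)) :=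
    Serre1972.le_unitGroup_adjoinElem_of_comm hab (y := ⟨y, hyG⟩) hys
  refine ⟨y, hyG, hys, fun l hl ↦ ?_, hle⟩
  obtain ⟨v, hv, hyv⟩ := Serre1972.exists_mulVec_eq_smul_of_root hl
  refine hirr v hv fun g hg ↦ mem_eigenvectorStabilizer_iff.mpr ?_
  obtain ⟨a, b, hab'⟩ := Serre1972.mem_adjoinElem_iff.mp (Serre1972.mem_unitGroup_iff.mp (hle hg))
  exact ⟨a + b * l, by rw [hab', Matrix.add_mulVec, Matrix.smul_mulVec, Matrix.smul_mulVec,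
    Matrix.one_mulVec, hyv, smul_smul, add_smul]⟩

/-- **A non-scalar element of determinant one** exists in a non-abelian `G` satisfying the
hypotheses of `not_dvd_card`: otherwise the kernel of `det : G → 𝔽_pˣ` would consist of
scalars, hence be central, with cyclic quotient (a subgroup of `𝔽_pˣ`), forcing `G` to be
abelian. [cite: CaraianiNewton2023, Lemma 7.1.1 (proof)] -/
theorem exists_det_eq_one_ne_smul_one (G : Subgroup (GL (Fin 2) (ZMod p)))
    (hab : ¬ ∀ a b : G, a * b = b * a) :
    ∃ s ∈ G, Matrix.GeneralLinearGroup.det s = 1 ∧ ∀ c : ZMod p, (s : Matrix (Fin 2) (Fin 2) (ZMod p)) ≠ c • 1 := by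
  by_contra! hall
  apply hab
  have hc : IsMulCommutative G := by
    refine MonoidHom.isMulCommutative_of_isCyclic_of_ker_le_center
      ((Matrix.GeneralLinearGroup.det).comp G.subtype) fun x hx ↦ ?_
    rw [MonoidHom.mem_ker, MonoidHom.comp_apply, Subgroup.subtype_apply] at hx
    obtain ⟨c, hc⟩ := hall x.1 x.2 hx
    exact DeligneSerre1974.mem_center_of_mat_eq x hc
  exact fun a b ↦ hc.is_comm.comm a b

/-- **Step (d): `G` normalises `𝔽_p[s]ˣ` for any non-scalar `s ∈ G` of determinant one.**
Under the hypotheses of `not_dvd_card`: every conjugate `k s k⁻¹`, `k ∈ G`, has determinant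
one, so commutes with `s` (`mul_comm_of_det_eq_one`), so lies in `𝔽_p[s]`
(`TwoByTwo.exists_eq_smul_one_add_smul_of_commute`); conclude by
`le_normalizer_unitGroup_adjoinElem_of_conj_mem`. [cite: CaraianiNewton2023, Lemma 7.1.1 (proof)] -/
theorem le_normalizer_unitGroup_adjoinElem_of_det_eq_one (G : Subgroup (GL (Fin 2) (ZMod p)))
    (hirr : ∀ (v : Fin 2 → ZMod p) (hv : v ≠ 0), ¬ G ≤ eigenvectorStabilizer v hv)
    (hred : ∃ (L : Type u) (_ : Field L) (f : ZMod p →+* L) (v : Fin 2 → L), v ≠ 0 ∧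
      ∀ g ∈ G, Matrix.GeneralLinearGroup.det g = 1 → ∃ c : L, ((g : Matrix (Fin 2) (Fin 2) (ZMod p)).map f) *ᵥ v = c • v)
    {s : GL (Fin 2) (ZMod p)} (hsG : s ∈ G) (hsdet : Matrix.GeneralLinearGroup.det s = 1)
    (hss : ∀ c : ZMod p, (s : Matrix (Fin 2) (Fin 2) (ZMod p)) ≠ c • 1) :
    G ≤ Subgroup.normalizer
      (Serre1972.unitGroup (Serre1972.adjoinElem (s : Matrix (Fin 2) (Fin 2) (ZMod p))) : Set (GL (Fin 2) (ZMod p))) := by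
  refine le_normalizer_unitGroup_adjoinElem_of_conj_mem hss fun k hk ↦ ?_
  have hs'G : k * s * k⁻¹ ∈ G := G.mul_mem (G.mul_mem hk hsG) (G.inv_mem hk)
  have hs'det : Matrix.GeneralLinearGroup.det (k * s * k⁻¹) = 1 := by
    rw [map_mul, map_mul, map_inv, hsdet, mul_one, mul_inv_cancel]
  have hcomm : s * (k * s * k⁻¹) = (k * s * k⁻¹) * s :=
    mul_comm_of_det_eq_one G hirr hred hsG hs'G hsdet hs'det
  have hcomm' : (s : Matrix (Fin 2) (Fin 2) (ZMod p)) * ((k * s * k⁻¹ : GL (Fin 2) (ZMod p)) : Matrix (Fin 2) (Fin 2) (ZMod p)) =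
      ((k * s * k⁻¹ : GL (Fin 2) (ZMod p)) : Matrix (Fin 2) (Fin 2) (ZMod p)) * s := by
    rw [← Units.val_mul, hcomm, Units.val_mul]
  obtain ⟨a, b, hab'⟩ :=
    DeligneSerre1974.TwoByTwo.exists_eq_smul_one_add_smul_of_commute hss hcomm'
  exact ⟨a, b, hab'⟩

/-- **Non-scalar elements are regular semisimple** (`p` odd): under the hypotheses of
`not_dvd_card`, a non-scalar `y ∈ G` has `tr(y)² - 4 det(y) ≠ 0`, because `y^{|G|} = 1` with
`p ∤ |G|` (`TwoByTwo.disc_ne_zero_of_pow_eq_one`). [folklore] -/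
theorem disc_ne_zero (hp2 : p ≠ 2) (G : Subgroup (GL (Fin 2) (ZMod p)))
    (hirr : ∀ (v : Fin 2 → ZMod p) (hv : v ≠ 0), ¬ G ≤ eigenvectorStabilizer v hv)
    (hred : ∃ (L : Type u) (_ : Field L) (f : ZMod p →+* L) (v : Fin 2 → L), v ≠ 0 ∧
      ∀ g ∈ G, Matrix.GeneralLinearGroup.det g = 1 → ∃ c : L, ((g : Matrix (Fin 2) (Fin 2) (ZMod p)).map f) *ᵥ v = c • v)
    {y : GL (Fin 2) (ZMod p)} (hyG : y ∈ G) (hys : ∀ c : ZMod p, (y : Matrix (Fin 2) (Fin 2) (ZMod p)) ≠ c • 1) :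
    (y : Matrix (Fin 2) (Fin 2) (ZMod p)).trace ^ 2 - 4 * (y : Matrix (Fin 2) (Fin 2) (ZMod p)).det ≠ 0 := by
  have htwo : (2 : ZMod p) ≠ 0 := DeligneSerre1974.two_ne_zero_of_ne_two hp2
  have hpG := not_dvd_card G hirr hred
  have hcardne : ((Nat.card G : ℕ) : ZMod p) ≠ 0 := by rwa [Ne, ZMod.natCast_eq_zero_iff]
  refine DeligneSerre1974.TwoByTwo.disc_ne_zero_of_pow_eq_one htwo hys (GL2.det_ne_zero y)
    hcardne ?_
  have h1 : (⟨y, hyG⟩ : G) ^ Nat.card G = 1 := pow_card_eq_one'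
  have h2 : y ^ Nat.card G = 1 := by
    have := congrArg Subtype.val h1
    simpa only [SubmonoidClass.mk_pow, OneMemClass.coe_one] using this
  rw [← Units.val_pow_eq_pow_val, h2, Units.val_one]

/-- **Caraiani–Newton, Lemma 7.1.1 (1)** (group-theoretic form, `p` odd). Let `G ⊆ GL₂(𝔽_p)`
act irreducibly on `𝔽_p²` (no `G`-stable line, i.e. `G` lies in no Borel subgroup
`eigenvectorStabilizer v`), and suppose that its determinant-one part `G ∩ SL₂(𝔽_p)` is
absolutely reducible: there are a field `L`, a homomorphism `f : 𝔽_p → L` and a non-zero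
`v ∈ L²` which is an eigenvector of `f(g)` for every `g ∈ G` with `det g = 1`.  Then `G` is
contained in the normaliser of a Cartan subgroup of `GL₂(𝔽_p)` (`Serre1972.cartanSubgroups`:
split `P (* 0; 0 *) P⁻¹` or non-split `kˣ`, `k ⊆ M₂(𝔽_p)` a field of degree `2`).

In the source this is stated for the image `G = ρ̄(G_F)` of an irreducible
`ρ̄ : G_F → GL₂(𝔽_p)` with cyclotomic determinant whose restriction to
`G_{F(ζ_p)} = ker(det ρ̄)` — i.e. `G ∩ SL₂(𝔽_p) = ρ̄(G_{F(ζ_p)})` — is absolutely reducible, and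
proved by appeal to [FLHS15, Lemma 2.2].  Proof here: by `not_dvd_card`, `p ∤ |G|`, and by
`mul_comm_of_det_eq_one` the determinant-one part is abelian.  If `G` is abelian it lies in
the (non-split) Cartan subgroup `𝔽_p[y]ˣ` of a non-scalar `y ∈ G`
(`exists_le_unitGroup_adjoinElem_of_comm`).  Otherwise some `s ∈ G` of determinant `1` is
non-scalar (`exists_det_eq_one_ne_smul_one`), it is regular semisimple (`disc_ne_zero`, this is
where `p ≠ 2` is used), so `𝔽_p[s]ˣ` is a Cartan subgroup, which `G` normalises
(`le_normalizer_unitGroup_adjoinElem_of_det_eq_one`).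
[cite: CaraianiNewton2023, Lemma 7.1.1 (1)] -/
theorem exists_le_normalizer_cartan (hp2 : p ≠ 2) (G : Subgroup (GL (Fin 2) (ZMod p)))
    (hirr : ∀ (v : Fin 2 → ZMod p) (hv : v ≠ 0), ¬ G ≤ eigenvectorStabilizer v hv)
    (hred : ∃ (L : Type u) (_ : Field L) (f : ZMod p →+* L) (v : Fin 2 → L), v ≠ 0 ∧
      ∀ g ∈ G, Matrix.GeneralLinearGroup.det g = 1 → ∃ c : L, ((g : Matrix (Fin 2) (Fin 2) (ZMod p)).map f) *ᵥ v = c • v) :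
    ∃ C ∈ Serre1972.cartanSubgroups (ZMod p),
      G ≤ Subgroup.normalizer (C : Set (GL (Fin 2) (ZMod p))) := by
  by_cases hab : ∀ a b : G, a * b = b * a
  · -- `G` abelian: inside the non-split Cartan subgroup `𝔽_p[y]ˣ`
    obtain ⟨y, -, hys, hno, hle⟩ := exists_le_unitGroup_adjoinElem_of_comm G hirr hab
    exact ⟨_, Serre1972.unitGroup_mem_cartanSubgroups (Serre1972.isField_adjoinElem hno)
      (Serre1972.finrank_adjoinElem hys), hle.trans Subgroup.le_normalizer⟩
  · -- `G` non-abelian: a non-scalar `s` of determinant one, and `G ⊆ N(𝔽_p[s]ˣ)`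
    obtain ⟨s, hsG, hsdet, hss⟩ := exists_det_eq_one_ne_smul_one G hab
    exact ⟨_, Serre1972.unitGroup_adjoinElem_mem_cartanSubgroups hss
      (disc_ne_zero hp2 G hirr hred hsG hss),
      le_normalizer_unitGroup_adjoinElem_of_det_eq_one G hirr hred hsG hsdet hss⟩

/-! ### Lemma 6.2.2 (proof): the group-theoretic step -/

/-- **From the proof of Caraiani–Newton, Lemma 6.2.2** ("The irreducibility of `ρ̄|_{G_{F(ζ_p)}}`
implies that `ρ̄(G_{F(ζ_p)})` either has order prime to `p` or contains `SL₂(𝔽_p)` (by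
Dickson's classification, or, more simply, [Ser72, Proposition 15])"): a subgroup `H` of
`GL₂(𝔽_p)` fixing no line of `𝔽_p²` has order prime to `p` or contains `SL₂(𝔽_p) = ker det` —
the contrapositive of Serre's Prop. 15 (`Serre1972.ker_det_le_or_exists_eigenvector_of_dvd_card`).
[cite: CaraianiNewton2023, Lemma 6.2.2 (proof)] -/
theorem not_dvd_card_or_ker_det_le (H : Subgroup (GL (Fin 2) (ZMod p)))
    (hirr : ∀ (v : Fin 2 → ZMod p) (hv : v ≠ 0), ¬ H ≤ eigenvectorStabilizer v hv) :
    ¬ p ∣ Nat.card H ∨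
      (Matrix.GeneralLinearGroup.det : GL (Fin 2) (ZMod p) →* (ZMod p)ˣ).ker ≤ H := by
  by_cases hpH : p ∣ Nat.card H
  · rcases Serre1972.ker_det_le_or_exists_eigenvector_of_dvd_card H hpH with hSL | ⟨v, hv, hHv⟩
    · exact Or.inr hSL
    · exact absurd (fun g hg ↦ mem_eigenvectorStabilizer_iff.mpr (hHv g hg)) (hirr v hv)
  · exact Or.inl hpH

/-- **From the proof of Caraiani–Newton, Lemma 6.2.2** ("It follows that we can find a
non-identity element `T ∈ Gal(L₁/F(ζ_p))` of order prime to `p`", where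
`Gal(L₁/F(ζ_p)) = Proj ρ̄ (G_{F(ζ_p)}) ⊆ PGL₂(𝔽_p)`): for `p` odd, a subgroup `H` of `GL₂(𝔽_p)`
fixing no line of `𝔽_p²` contains an element whose image in `PGL₂(𝔽_p)` is a non-identity
element of order prime to `p` — a non-scalar element of `H` if `p ∤ |H|`, and
`w = (0 -1; 1 0) ∈ SL₂(𝔽_p) ⊆ H` (of order `4`) otherwise (`not_dvd_card_or_ker_det_le`).
[cite: CaraianiNewton2023, Lemma 6.2.2 (proof)] -/
theorem exists_projective_ne_one_not_dvd_orderOf (hp2 : p ≠ 2) (H : Subgroup (GL (Fin 2) (ZMod p)))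
    (hirr : ∀ (v : Fin 2 → ZMod p) (hv : v ≠ 0), ¬ H ≤ eigenvectorStabilizer v hv) :
    ∃ h ∈ H, Matrix.ProjGenLinGroup.mk h ≠ 1 ∧ ¬ p ∣ orderOf (Matrix.ProjGenLinGroup.mk h) := by
  have hp : p.Prime := Fact.out
  -- non-scalar elements have non-identity image in `PGL₂`
  have hne : ∀ h : GL (Fin 2) (ZMod p), (∀ c : ZMod p, (h : Matrix (Fin 2) (Fin 2) (ZMod p)) ≠ c • 1) →
      Matrix.ProjGenLinGroup.mk h ≠ 1 := by
    intro h hhs h1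
    rw [Matrix.ProjGenLinGroup.mk_eq_one, Matrix.GeneralLinearGroup.center_eq_range_scalar] at h1
    obtain ⟨u, hu⟩ := h1
    apply hhs (u : ZMod p)
    rw [← hu, Matrix.GeneralLinearGroup.coe_scalar, Matrix.scalar_apply,
      Matrix.smul_one_eq_diagonal]
  rcases not_dvd_card_or_ker_det_le H hirr with hpH | hSL
  · obtain ⟨h, hhH, hhs⟩ := exists_mem_ne_smul_one H hirr
    refine ⟨h, hhH, hne h hhs, fun hdvd ↦ hpH ?_⟩
    exact hdvd.trans ((orderOf_map_dvd _ h).trans (H.orderOf_dvd_natCard hhH))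
  · have hwdet : (!![0, -1; 1, 0] : Matrix (Fin 2) (Fin 2) (ZMod p)).det ≠ 0 := by simp [Matrix.det_fin_two_of]
    set w : GL (Fin 2) (ZMod p) := Matrix.GeneralLinearGroup.mkOfDetNeZero _ hwdet with hw
    have hwcoe : (w : Matrix (Fin 2) (Fin 2) (ZMod p)) = !![0, -1; 1, 0] := rfl
    have hwH : w ∈ H := by
      refine hSL ?_
      rw [MonoidHom.mem_ker]
      ext
      rw [Matrix.GeneralLinearGroup.val_det_apply, hwcoe, Units.val_one]
      simp [Matrix.det_fin_two_of]
    have hws : ∀ c : ZMod p, (w : Matrix (Fin 2) (Fin 2) (ZMod p)) ≠ c • 1 := by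
      intro c hc
      have := congrFun (congrFun hc 1) 0
      simp [hwcoe] at this
    have hw4 : w ^ 4 = 1 := by
      have hw2 : (w : Matrix (Fin 2) (Fin 2) (ZMod p)) * w = -1 := by
        rw [hwcoe]
        ext i j
        fin_cases i <;> fin_cases j <;> simp [Matrix.mul_apply, Fin.sum_univ_two]
      apply Units.ext
      rw [Units.val_pow_eq_pow_val, show (4 : ℕ) = 2 + 2 from rfl, pow_add, sq, hw2,
        Units.val_one, neg_mul_neg, one_mul]
    refine ⟨w, hwH, hne w hws, fun hdvd ↦ hp2 ?_⟩
    have h4 : p ∣ 4 := hdvd.trans ((orderOf_map_dvd _ w).trans (orderOf_dvd_of_pow_eq_one hw4))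
    have : p ∣ 2 ^ 2 := by simpa using h4
    exact (Nat.prime_dvd_prime_iff_eq hp Nat.prime_two).mp (hp.dvd_of_dvd_pow this)

end Prime

/-! ### `p = 3`: Lemma 7.1.1 (2) -/

section Three

/-- **Caraiani–Newton, Lemma 7.1.1 (2)** (`p = 3`, group-theoretic form). Let `G ⊆ GL₂(𝔽₃)`
fix no line of `𝔽₃²` and let `G ∩ SL₂(𝔽₃)` have a common eigenvector over some extension
field (the hypotheses of `exists_le_normalizer_cartan`). Then either `G` **is** the normaliser
`C_s⁺(3)` of a split Cartan subgroup (`G = N(P (* 0; 0 *) P⁻¹)`, dihedral of order `8`), or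
`G` is contained in a non-split Cartan subgroup `C_ns(3) = kˣ` (`k ⊆ M₂(𝔽₃)` a field of
degree `2`).  Source: "`ρ̄(G_F)` is conjugate to `C_s⁺(3)` (the normalizer of a split Cartan
subgroup of `GL₂(𝔽₃)`) or to a subgroup of `C_ns(3)` (a non-split Cartan)".

Proof.  If `G` is abelian, `exists_le_unitGroup_adjoinElem_of_comm`.  Otherwise take `s ∈ G`
non-scalar of determinant `1` (`exists_det_eq_one_ne_smul_one`); it is regular semisimple
(`disc_ne_zero`), which over `𝔽₃` with `det s = 1` forces `tr s = 0`, `s² = -1`, so that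
`k = 𝔽₃[s] ≅ 𝔽₉` and `G ⊆ N(kˣ)` (`le_normalizer_unitGroup_adjoinElem_of_det_eq_one`).  An
element `g ∈ G ∖ kˣ` conjugates `s` to `s̄ = -s` (Serre, `conj_eq_or_conj_eq_of_mem_normalizer`),
so `det g = -1` (determinant-one elements commute with `s`) and `g²` is a scalar, necessarily
`+1` (`g² = -1 = (tr g) g + 1` would make `g` scalar).  Fix such an involution `g₀` and let `P`
have its `±1`-eigenvectors as columns.  In this basis `g₀ = diag(1, -1)`, `s` is antidiagonal
(it anticommutes with `g₀`), the elements of `G ∩ kˣ` are the `a + b s` with `ab = 0` (if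
`ab ≠ 0` then `det (a + b s) = -1` and `g₀ (a + b s) ∈ G ∖ kˣ` would have determinant `1`),
and `g g₀ ∈ kˣ` for `g ∈ G ∖ kˣ`; so every element of `G` is diagonal or antidiagonal in the
basis `P`, i.e. normalises `P (* 0; 0 *) P⁻¹` (Serre, `mem_normalizer_splitCartan_iff`), and
conversely the diagonal elements `±1, ±g₀` of that normaliser lie in `G`, and its antidiagonal
elements `h` have `h s⁻¹` diagonal.
[cite: CaraianiNewton2023, Lemma 7.1.1 (2)] -/
theorem eq_normalizer_splitCartan_or_le_unitGroup (G : Subgroup (GL (Fin 2) (ZMod 3)))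
    (hirr : ∀ (v : Fin 2 → ZMod 3) (hv : v ≠ 0), ¬ G ≤ eigenvectorStabilizer v hv)
    (hred : ∃ (L : Type u) (_ : Field L) (f : ZMod 3 →+* L) (v : Fin 2 → L), v ≠ 0 ∧
      ∀ g ∈ G, Matrix.GeneralLinearGroup.det g = 1 → ∃ c : L, ((g : Matrix (Fin 2) (Fin 2) (ZMod 3)).map f) *ᵥ v = c • v) :
    (∃ P : GL (Fin 2) (ZMod 3),
        G = Subgroup.normalizer (Serre1972.splitCartan P : Set (GL (Fin 2) (ZMod 3)))) ∨
      ∃ k : Subalgebra (ZMod 3) (Matrix (Fin 2) (Fin 2) (ZMod 3)), IsField k ∧ Module.finrank (ZMod 3) k = 2 ∧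
        G ≤ Serre1972.unitGroup k := by
  classical
  by_cases hab : ∀ a b : G, a * b = b * a
  · right
    obtain ⟨y, -, hys, hno, hle⟩ := exists_le_unitGroup_adjoinElem_of_comm G hirr hab
    exact ⟨_, Serre1972.isField_adjoinElem hno, Serre1972.finrank_adjoinElem hys, hle⟩
  left
  /- a non-scalar `s` of determinant one: `tr s = 0`, `s² = -1`, `k = 𝔽₃[s]` a field -/
  obtain ⟨s, hsG, hsdet, hss⟩ := exists_det_eq_one_ne_smul_one G hab
  have hdisc := disc_ne_zero (by decide) G hirr hred hsG hss
  have hdet1 : (s : Matrix (Fin 2) (Fin 2) (ZMod 3)).det = 1 := by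
    rw [← Matrix.GeneralLinearGroup.val_det_apply, hsdet, Units.val_one]
  have htr0 : (s : Matrix (Fin 2) (Fin 2) (ZMod 3)).trace = 0 := by
    have key : ∀ t : ZMod 3, t ^ 2 - 4 * 1 ≠ 0 → t = 0 := by decide
    exact key _ (by rwa [hdet1] at hdisc)
  have hsq : (s : Matrix (Fin 2) (Fin 2) (ZMod 3)) * s = -1 := by
    have h := DeligneSerre1974.TwoByTwo.mul_self_eq (s : Matrix (Fin 2) (Fin 2) (ZMod 3))
    rw [htr0, hdet1, zero_smul, one_smul, zero_sub] at h
    exact h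
  have hsq' : s * s = -1 :=
    Units.ext (by rw [Units.val_mul, hsq, Units.val_neg, Units.val_one])
  have hnegone : (-1 : GL (Fin 2) (ZMod 3)) ∈ G := by rw [← hsq']; exact G.mul_mem hsG hsG
  have hno : ∀ l : ZMod 3, l ^ 2 - (s : Matrix (Fin 2) (Fin 2) (ZMod 3)).trace * l + (s : Matrix (Fin 2) (Fin 2) (ZMod 3)).det ≠ 0 := by
    rw [htr0, hdet1]; decide
  set k : Subalgebra (ZMod 3) (Matrix (Fin 2) (Fin 2) (ZMod 3)) := Serre1972.adjoinElem (s : Matrix (Fin 2) (Fin 2) (ZMod 3)) with hk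
  have hkf : IsField k := Serre1972.isField_adjoinElem hno
  have hsk : (s : Matrix (Fin 2) (Fin 2) (ZMod 3)) ∈ k := Serre1972.self_mem_adjoinElem _
  have hGN : G ≤ Subgroup.normalizer (Serre1972.unitGroup k : Set (GL (Fin 2) (ZMod 3))) :=
    le_normalizer_unitGroup_adjoinElem_of_det_eq_one G hirr hred hsG hsdet hss
  /- elements of `G` outside `kˣ`: `g s g⁻¹ = -s`, `det g = -1`, `g² = 1` -/
  have hout : ∀ g ∈ G, g ∉ Serre1972.unitGroup k →
      g * s * g⁻¹ = -s ∧ Matrix.GeneralLinearGroup.det g = -1 ∧ g * g = 1 := by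
    intro g hgG hgC
    have hgu : IsUnit (g : Matrix (Fin 2) (Fin 2) (ZMod 3)).det := (GL2.det_ne_zero g).isUnit
    have hconj' : (g : Matrix (Fin 2) (Fin 2) (ZMod 3)) * s * (g : Matrix (Fin 2) (Fin 2) (ZMod 3))⁻¹ = (s : Matrix (Fin 2) (Fin 2) (ZMod 3)).trace • 1 - s := by
      rcases Serre1972.conj_eq_or_conj_eq_of_mem_normalizer hkf hsk hss (hGN hgG) with h | h
      · exact absurd (Serre1972.mem_unitGroup_of_conj_eq hsk hss h) hgC
      · exact h
    have hconj : (g : Matrix (Fin 2) (Fin 2) (ZMod 3)) * s * (g : Matrix (Fin 2) (Fin 2) (ZMod 3))⁻¹ = -(s : Matrix (Fin 2) (Fin 2) (ZMod 3)) := by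
      rw [hconj', htr0, zero_smul, zero_sub]
    have hconjGL : g * s * g⁻¹ = -s :=
      Units.ext (by rw [Units.val_mul, Units.val_mul, Matrix.coe_units_inv, hconj, Units.val_neg])
    -- `det g ≠ 1`
    have hdetg1 : Matrix.GeneralLinearGroup.det g ≠ 1 := by
      intro hg1
      have hc := mul_comm_of_det_eq_one G hirr hred hsG hgG hsdet hg1
      have hfix : g * s * g⁻¹ = s := by rw [← hc, mul_inv_cancel_right]
      rw [hfix] at hconjGL
      have h2s : (2 : ZMod 3) • (s : Matrix (Fin 2) (Fin 2) (ZMod 3)) = 0 := by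
        rw [two_smul]
        nth_rewrite 2 [hconjGL]
        rw [Units.val_neg, add_neg_cancel]
      have hs0 : (s : Matrix (Fin 2) (Fin 2) (ZMod 3)) = 0 := by
        rcases smul_eq_zero.mp h2s with h | h
        · exact absurd h (by decide)
        · exact h
      exact GL2.det_ne_zero s (by rw [hs0, Matrix.det_zero])
    have hdetg : Matrix.GeneralLinearGroup.det g = -1 := by
      have key : ∀ u : (ZMod 3)ˣ, u ≠ 1 → u = -1 := by decide
      exact key _ hdetg1
    -- `g²` is a scalar `c`, and `c = 1`
    obtain ⟨c, hc⟩ := Serre1972.sq_eq_smul_one_of_conj_eq hss hdisc hconj'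
    have hgg : (g : Matrix (Fin 2) (Fin 2) (ZMod 3)) * g = c • 1 := by rw [← Units.val_mul, ← sq, hc]
    have hdetgv : (g : Matrix (Fin 2) (Fin 2) (ZMod 3)).det = -1 := by
      rw [← Matrix.GeneralLinearGroup.val_det_apply, hdetg, Units.val_neg, Units.val_one]
    have hCH := DeligneSerre1974.TwoByTwo.mul_self_eq (g : Matrix (Fin 2) (Fin 2) (ZMod 3))
    rw [hgg, hdetgv, neg_smul, one_smul, sub_neg_eq_add] at hCH
    -- `hCH : c • 1 = tr(g) • g + 1`
    have hcsq : c ^ 2 = 1 := by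
      have := congrArg Matrix.det hgg
      rw [Matrix.det_mul, hdetgv, Matrix.det_smul, Matrix.det_one, Fintype.card_fin,
        mul_one] at this
      linear_combination -this
    have hc1 : c = 1 := by
      have key : ∀ c : ZMod 3, c ^ 2 = 1 → c = 1 ∨ c = -1 := by decide
      rcases key c hcsq with h | h
      · exact h
      · exfalso
        rw [h] at hCH
        -- `-1 = tr(g) g + 1`, i.e. `tr(g) g = -2 = 1`
        have htg : (g : Matrix (Fin 2) (Fin 2) (ZMod 3)).trace • (g : Matrix (Fin 2) (Fin 2) (ZMod 3)) = (1 : Matrix (Fin 2) (Fin 2) (ZMod 3)) := by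
          have e : (g : Matrix (Fin 2) (Fin 2) (ZMod 3)).trace • (g : Matrix (Fin 2) (Fin 2) (ZMod 3)) = (-1 : ZMod 3) • (1 : Matrix (Fin 2) (Fin 2) (ZMod 3)) - 1 :=
            eq_sub_of_add_eq hCH.symm
          have e2 : (-1 : ZMod 3) • (1 : Matrix (Fin 2) (Fin 2) (ZMod 3)) - 1 = ((-1 : ZMod 3) - 1) • (1 : Matrix (Fin 2) (Fin 2) (ZMod 3)) := by
            rw [sub_smul, one_smul]
          have e3 : ((-1 : ZMod 3) - 1) = 1 := by decide
          rw [e, e2, e3, one_smul]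
        by_cases htr : (g : Matrix (Fin 2) (Fin 2) (ZMod 3)).trace = 0
        · rw [htr, zero_smul] at htg
          exact one_ne_zero htg.symm
        · apply hgC
          rw [Serre1972.mem_unitGroup_iff]
          have : (g : Matrix (Fin 2) (Fin 2) (ZMod 3)) = (g : Matrix (Fin 2) (Fin 2) (ZMod 3)).trace⁻¹ • 1 := by
            rw [← htg, smul_smul, inv_mul_cancel₀ htr, one_smul]
          rw [this]
          exact Serre1972.smul_one_mem_adjoinElem _ _
    refine ⟨hconjGL, hdetg, Units.ext ?_⟩
    rw [Units.val_mul, hgg, hc1, one_smul, Units.val_one]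
  /- `G ⊄ kˣ`: an involution `g₀ ∈ G ∖ kˣ`, `tr g₀ = 0` -/
  obtain ⟨g₀, hg₀G, hg₀C⟩ : ∃ g₀ ∈ G, g₀ ∉ Serre1972.unitGroup k := by
    by_contra! hall
    exact hab fun a b ↦ Subtype.ext
      (Serre1972.mul_comm_of_mem_unitGroup_adjoinElem (hall a.1 a.2) (hall b.1 b.2))
  obtain ⟨hg₀conj, hg₀det, hg₀sq⟩ := hout g₀ hg₀G hg₀C
  have hg₀sqm : (g₀ : Matrix (Fin 2) (Fin 2) (ZMod 3)) * g₀ = 1 := by rw [← Units.val_mul, hg₀sq, Units.val_one]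
  have hg₀detv : (g₀ : Matrix (Fin 2) (Fin 2) (ZMod 3)).det = -1 := by
    rw [← Matrix.GeneralLinearGroup.val_det_apply, hg₀det, Units.val_neg, Units.val_one]
  have hg₀tr : (g₀ : Matrix (Fin 2) (Fin 2) (ZMod 3)).trace = 0 := by
    have hCH := DeligneSerre1974.TwoByTwo.mul_self_eq (g₀ : Matrix (Fin 2) (Fin 2) (ZMod 3))
    rw [hg₀sqm, hg₀detv, neg_smul, one_smul, sub_neg_eq_add] at hCH
    -- `hCH : 1 = tr • g₀ + 1`
    have h0 : (g₀ : Matrix (Fin 2) (Fin 2) (ZMod 3)).trace • (g₀ : Matrix (Fin 2) (Fin 2) (ZMod 3)) = 0 := by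
      have := (add_eq_right (b := (1 : Matrix (Fin 2) (Fin 2) (ZMod 3)))).mp hCH.symm
      exact this
    rcases smul_eq_zero.mp h0 with h | h
    · exact h
    · exfalso
      have := congrArg Matrix.det h
      rw [hg₀detv, Matrix.det_zero] at this
      exact absurd this (by decide)
  /- the `±1`-eigenvectors `v, w` of `g₀`, and `P = (v w)` -/
  obtain ⟨v, hv, hg₀v⟩ : ∃ v : Fin 2 → ZMod 3, v ≠ 0 ∧ (g₀ : Matrix (Fin 2) (Fin 2) (ZMod 3)) *ᵥ v = (1 : ZMod 3) • v :=
    Serre1972.exists_mulVec_eq_smul_of_root (by rw [hg₀tr, hg₀detv]; ring)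
  obtain ⟨w, hw, hg₀w⟩ : ∃ w : Fin 2 → ZMod 3, w ≠ 0 ∧ (g₀ : Matrix (Fin 2) (Fin 2) (ZMod 3)) *ᵥ w = (-1 : ZMod 3) • w :=
    Serre1972.exists_mulVec_eq_smul_of_root (by rw [hg₀tr, hg₀detv]; ring)
  have hvw : v 0 * w 1 - w 0 * v 1 ≠ 0 := by
    intro h
    obtain ⟨c, hc⟩ := Serre1972.exists_eq_smul_of_det_eq_zero hv h
    have h1 : (g₀ : Matrix (Fin 2) (Fin 2) (ZMod 3)) *ᵥ w = w := by rw [hc, Matrix.mulVec_smul, hg₀v, one_smul]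
    rw [h1, neg_one_smul] at hg₀w
    apply hw
    have h2 : (2 : ZMod 3) • w = 0 := by
      rw [two_smul]
      nth_rewrite 2 [hg₀w]
      rw [add_neg_cancel]
    rcases smul_eq_zero.mp h2 with h3 | h3
    · exact absurd h3 (by decide)
    · exact h3
  set Pm : Matrix (Fin 2) (Fin 2) (ZMod 3) := !![v 0, w 0; v 1, w 1] with hPm
  have hPdet : Pm.det ≠ 0 := by rwa [hPm, Matrix.det_fin_two_of]
  set P : GL (Fin 2) (ZMod 3) := Matrix.GeneralLinearGroup.mkOfDetNeZero Pm hPdet with hP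
  have hPcoe : (P : Matrix (Fin 2) (Fin 2) (ZMod 3)) = Pm := rfl
  have hPu : IsUnit (P : Matrix (Fin 2) (Fin 2) (ZMod 3)).det := (GL2.det_ne_zero P).isUnit
  -- conjugation by `P`
  have hφmul : ∀ x y : GL (Fin 2) (ZMod 3),
      (P⁻¹ * (x * y) * P : GL (Fin 2) (ZMod 3)) = (P⁻¹ * x * P) * (P⁻¹ * y * P) := by
    intro x y; group
  have hφinj : ∀ x y : GL (Fin 2) (ZMod 3),
      ((P⁻¹ * x * P : GL (Fin 2) (ZMod 3)) : Matrix (Fin 2) (Fin 2) (ZMod 3)) = ((P⁻¹ * y * P : GL (Fin 2) (ZMod 3)) : Matrix (Fin 2) (Fin 2) (ZMod 3)) →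
        x = y := by
    intro x y hxy
    have h := Units.ext (α := Matrix (Fin 2) (Fin 2) (ZMod 3)) hxy
    calc x = P * (P⁻¹ * x * P) * P⁻¹ := by group
      _ = P * (P⁻¹ * y * P) * P⁻¹ := by rw [h]
      _ = y := by group
  have hφneg : ∀ x : GL (Fin 2) (ZMod 3),
      ((P⁻¹ * -x * P : GL (Fin 2) (ZMod 3)) : Matrix (Fin 2) (Fin 2) (ZMod 3)) = -((P⁻¹ * x * P : GL (Fin 2) (ZMod 3)) : Matrix (Fin 2) (Fin 2) (ZMod 3)) := by
    intro x
    simp only [Units.val_mul, Units.val_neg, Matrix.mul_neg, Matrix.neg_mul]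
  have hφsmul : ∀ (x : GL (Fin 2) (ZMod 3)) (b : ZMod 3) (y : Matrix (Fin 2) (Fin 2) (ZMod 3)), (x : Matrix (Fin 2) (Fin 2) (ZMod 3)) = b • y →
      ((P⁻¹ * x * P : GL (Fin 2) (ZMod 3)) : Matrix (Fin 2) (Fin 2) (ZMod 3)) = b • ((P : Matrix (Fin 2) (Fin 2) (ZMod 3))⁻¹ * y * P) := by
    intro x b y hx
    simp only [Units.val_mul, Matrix.coe_units_inv, hx, Matrix.mul_smul, Matrix.smul_mul]
  -- `D = P⁻¹ g₀ P = diag(1, -1)`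
  set D : Matrix (Fin 2) (Fin 2) (ZMod 3) := ((P⁻¹ * g₀ * P : GL (Fin 2) (ZMod 3)) : Matrix (Fin 2) (Fin 2) (ZMod 3)) with hD
  have hDeq : D = Matrix.diagonal ![(1 : ZMod 3), -1] := by
    have hgP : (g₀ : Matrix (Fin 2) (Fin 2) (ZMod 3)) * Pm = Pm * Matrix.diagonal ![(1 : ZMod 3), -1] := by
      rw [hPm, Serre1972.mul_cols, hg₀v, hg₀w]
      ext i j
      fin_cases i <;> fin_cases j <;> simp [Matrix.mul_apply, Fin.sum_univ_two]
    rw [hD, Units.val_mul, Units.val_mul, Matrix.coe_units_inv, hPcoe, Matrix.mul_assoc, hgP,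
      ← Matrix.mul_assoc, Matrix.nonsing_inv_mul _ (hPcoe ▸ hPu), Matrix.one_mul]
  have hDdg : GL2.IsDg D := by rw [hDeq]; exact GL2.isDg_diagonal _
  -- `S = P⁻¹ s P` is antidiagonal: it anticommutes with `D`
  set S : Matrix (Fin 2) (Fin 2) (ZMod 3) := ((P⁻¹ * s * P : GL (Fin 2) (ZMod 3)) : Matrix (Fin 2) (Fin 2) (ZMod 3)) with hS
  have hDS : D * S = -(S * D) := by
    have h1 : g₀ * s = -s * g₀ := by
      calc g₀ * s = g₀ * s * g₀⁻¹ * g₀ := by group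
        _ = -s * g₀ := by rw [hg₀conj]
    have h2 : (P⁻¹ * g₀ * P) * (P⁻¹ * s * P) = -((P⁻¹ * s * P) * (P⁻¹ * g₀ * P)) := by
      calc (P⁻¹ * g₀ * P) * (P⁻¹ * s * P) = P⁻¹ * (g₀ * s) * P := (hφmul _ _).symm
        _ = P⁻¹ * (-(s * g₀)) * P := by rw [h1, neg_mul]
        _ = -(P⁻¹ * (s * g₀) * P) := by rw [mul_neg, neg_mul]
        _ = -((P⁻¹ * s * P) * (P⁻¹ * g₀ * P)) := by rw [hφmul]
    rw [hD, hS, ← Units.val_mul, h2, Units.val_neg, Units.val_mul]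
  have hSad : GL2.IsAd S := by
    rw [hDeq] at hDS
    have e00 := congrFun (congrFun hDS 0) 0
    have e11 := congrFun (congrFun hDS 1) 1
    simp [Matrix.mul_apply, Matrix.diagonal] at e00 e11
    have key : ∀ x : ZMod 3, x = -x → x = 0 := by decide
    exact ⟨key _ e00, key _ e11.symm⟩
  have hF : ∃ u : (ZMod 3)ˣ, u ≠ 1 := Serre1972.exists_units_ne_one (p := 3) (by decide)
  /- `G ⊆ N(P (* 0; 0 *) P⁻¹)`: every element of `G` is diagonal or antidiagonal in the basis `P` -/
  have hin : ∀ g ∈ G, g ∈ Serre1972.unitGroup k →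
      GL2.IsDg ((P⁻¹ * g * P : GL (Fin 2) (ZMod 3)) : Matrix (Fin 2) (Fin 2) (ZMod 3)) ∨
        GL2.IsAd ((P⁻¹ * g * P : GL (Fin 2) (ZMod 3)) : Matrix (Fin 2) (Fin 2) (ZMod 3)) := by
    intro g hgG hgk
    obtain ⟨a, b, hab'⟩ := Serre1972.mem_adjoinElem_iff.mp (Serre1972.mem_unitGroup_iff.mp hgk)
    -- `a b = 0`
    have hab0 : a = 0 ∨ b = 0 := by
      by_contra! hne
      obtain ⟨ha, hb⟩ := hne
      have hdetg : (g : Matrix (Fin 2) (Fin 2) (ZMod 3)).det = -1 := by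
        rw [hab', DeligneSerre1974.TwoByTwo.det_smul_one_add_smul, htr0, hdet1]
        have key : ∀ a b : ZMod 3, a ≠ 0 → b ≠ 0 → a ^ 2 + a * b * 0 + b ^ 2 * 1 = -1 := by
          decide
        exact key a b ha hb
      -- `g₀ g ∈ G` has determinant `1`, hence lies in `kˣ`; then so does `g₀`
      have hg' : g₀ * g ∈ G := G.mul_mem hg₀G hgG
      have hdetgU : Matrix.GeneralLinearGroup.det g = -1 :=
        Units.ext (by rw [Matrix.GeneralLinearGroup.val_det_apply, hdetg, Units.val_neg,
          Units.val_one])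
      have hg'det : Matrix.GeneralLinearGroup.det (g₀ * g) = 1 := by
        rw [map_mul, hg₀det, hdetgU, neg_mul_neg, one_mul]
      have hg'k : g₀ * g ∈ Serre1972.unitGroup k := by
        by_contra hnot
        have := (hout _ hg' hnot).2.1
        rw [hg'det] at this
        exact absurd this (by decide)
      apply hg₀C
      have : g₀ = (g₀ * g) * g⁻¹ := by group
      rw [this]
      exact (Serre1972.unitGroup k).mul_mem hg'k ((Serre1972.unitGroup k).inv_mem hgk)
    rcases hab0 with ha | hb
    · right
      rw [ha, zero_smul, zero_add] at hab'
      rw [hφsmul g b s hab']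
      have : (P : Matrix (Fin 2) (Fin 2) (ZMod 3))⁻¹ * s * P = S := by rw [hS, Units.val_mul, Units.val_mul, Matrix.coe_units_inv]
      rw [this]
      exact hSad.smul b
    · left
      rw [hb, zero_smul, add_zero] at hab'
      rw [hφsmul g a 1 hab', Matrix.mul_one, Matrix.nonsing_inv_mul _ hPu]
      exact GL2.isDg_smul_one a
  have hGle : G ≤ Subgroup.normalizer (Serre1972.splitCartan P : Set (GL (Fin 2) (ZMod 3))) := by
    intro g hgG
    rw [Serre1972.mem_normalizer_splitCartan_iff hF]
    by_cases hgk : g ∈ Serre1972.unitGroup k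
    · exact hin g hgG hgk
    · -- `g g₀ ∈ kˣ`
      obtain ⟨hgconj, -, -⟩ := hout g hgG hgk
      have hgg₀k : g * g₀ ∈ Serre1972.unitGroup k := by
        have hc : (g * g₀) * s * (g * g₀)⁻¹ = s := by
          calc (g * g₀) * s * (g * g₀)⁻¹ = g * (g₀ * s * g₀⁻¹) * g⁻¹ := by group
            _ = s := by rw [hg₀conj, mul_neg, neg_mul, hgconj, neg_neg]
        refine Serre1972.mem_unitGroup_of_conj_eq hsk hss ?_
        have := congrArg (fun x : GL (Fin 2) (ZMod 3) ↦ (x : Matrix (Fin 2) (Fin 2) (ZMod 3))) hc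
        simpa only [Units.val_mul, Matrix.coe_units_inv] using this
      have hsplit : (P⁻¹ * g * P : GL (Fin 2) (ZMod 3)) = (P⁻¹ * (g * g₀) * P) * (P⁻¹ * g₀ * P) := by
        rw [← hφmul, mul_assoc g g₀ g₀, hg₀sq, mul_one]
      rw [hsplit, Units.val_mul]
      rcases hin _ (G.mul_mem hgG hg₀G) hgg₀k with h | h
      · exact Or.inl (h.mul hDdg)
      · exact Or.inr (h.mul_isDg hDdg)
  /- `N(P (* 0; 0 *) P⁻¹) ⊆ G` -/
  have hDg : ∀ h ∈ Subgroup.normalizer (Serre1972.splitCartan P : Set (GL (Fin 2) (ZMod 3))),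
      GL2.IsDg ((P⁻¹ * h * P : GL (Fin 2) (ZMod 3)) : Matrix (Fin 2) (Fin 2) (ZMod 3)) → h ∈ G := by
    intro h _ hd
    set X : Matrix (Fin 2) (Fin 2) (ZMod 3) := ((P⁻¹ * h * P : GL (Fin 2) (ZMod 3)) : Matrix (Fin 2) (Fin 2) (ZMod 3)) with hX
    have hXdet : X 0 0 * X 1 1 ≠ 0 := by
      rw [← GL2.det_of_isDg hd]
      exact GL2.det_ne_zero _
    have hXeq : X = Matrix.diagonal ![X 0 0, X 1 1] := hd.eq_diagonal
    have key : ∀ a d : ZMod 3, a * d ≠ 0 →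
        (a = 1 ∧ d = 1) ∨ (a = -1 ∧ d = -1) ∨ (a = 1 ∧ d = -1) ∨ (a = -1 ∧ d = 1) := by decide
    have hdiag1 : Matrix.diagonal ![(1 : ZMod 3), 1] = 1 := by
      ext i j; fin_cases i <;> fin_cases j <;> simp [Matrix.diagonal]
    have hdiagm : Matrix.diagonal ![(-1 : ZMod 3), -1] = -1 := by
      ext i j; fin_cases i <;> fin_cases j <;> simp [Matrix.diagonal]
    have hdiagm' : Matrix.diagonal ![(-1 : ZMod 3), 1] = -Matrix.diagonal ![(1 : ZMod 3), -1] := by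
      ext i j; fin_cases i <;> fin_cases j <;> simp [Matrix.diagonal]
    rcases key _ _ hXdet with ⟨ha, hd'⟩ | ⟨ha, hd'⟩ | ⟨ha, hd'⟩ | ⟨ha, hd'⟩ <;>
      rw [ha, hd'] at hXeq
    · -- `h = 1`
      have : h = 1 := hφinj h 1 (by rw [← hX, hXeq, hdiag1]; simp)
      rw [this]; exact G.one_mem
    · -- `h = -1`
      have : h = -1 := hφinj h (-1) (by
        rw [← hX, hXeq, hdiagm, hφneg]; simp)
      rw [this]; exact hnegone
    · -- `h = g₀`
      have : h = g₀ := hφinj h g₀ (by rw [← hX, hXeq, ← hDeq])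
      rw [this]; exact hg₀G
    · -- `h = -g₀`
      have : h = -g₀ := hφinj h (-g₀) (by rw [← hX, hXeq, hdiagm', ← hDeq, hφneg])
      rw [this, ← neg_one_mul]
      exact G.mul_mem hnegone hg₀G
  refine ⟨P, le_antisymm hGle fun h hh ↦ ?_⟩
  rcases (Serre1972.mem_normalizer_splitCartan_iff hF).mp hh with hd | ha
  · exact hDg h hh hd
  · -- `h s⁻¹` is diagonal in the basis `P`
    have hsN : s ∈ Subgroup.normalizer (Serre1972.splitCartan P : Set (GL (Fin 2) (ZMod 3))) :=
      hGle hsG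
    have hh' : h * s⁻¹ ∈ Subgroup.normalizer (Serre1972.splitCartan P : Set (GL (Fin 2) (ZMod 3))) :=
      Subgroup.mul_mem _ hh (Subgroup.inv_mem _ hsN)
    have hSad' : GL2.IsAd ((P⁻¹ * s⁻¹ * P : GL (Fin 2) (ZMod 3)) : Matrix (Fin 2) (Fin 2) (ZMod 3)) := by
      have : (P⁻¹ * s⁻¹ * P : GL (Fin 2) (ZMod 3)) = (P⁻¹ * s * P)⁻¹ := by group
      rw [this, Matrix.coe_units_inv]
      exact hSad.inv
    have hd : GL2.IsDg ((P⁻¹ * (h * s⁻¹) * P : GL (Fin 2) (ZMod 3)) : Matrix (Fin 2) (Fin 2) (ZMod 3)) := by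
      rw [hφmul, Units.val_mul]
      exact ha.mul hSad'
    have := hDg _ hh' hd
    have e : h = h * s⁻¹ * s := by group
    rw [e]
    exact G.mul_mem this hsG

end Three

/-! ### `p = 5`: Lemma 7.1.1 (3) -/

section Five

/-! Mathlib registers `Fact (Nat.Prime p)` instances only for `p = 2, 3`; for `p = 5` the
(true, `Nat.prime_five`) instance is taken as an instance argument `[Fact (Nat.Prime 5)]`,
which any user discharges by `⟨Nat.prime_five⟩`. -/

/-- Finite checks in `𝔽₅` (stated before the `Fact (Nat.Prime 5)` variable, so that `decide`
sees closed terms). [folklore] -/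
private theorem zmod5_trace_eq_zero :
    ∀ t l : ZMod 5, l ^ 2 - t * l + 1 = 0 → t ^ 2 - 4 * 1 ≠ 0 → t = 0 := by decide

/-- [folklore] -/
private theorem zmod5_ne_of_mul_eq_one : ∀ a d : ZMod 5, a * d = 1 → a + d = 0 → a ≠ d := by
  decide

/-- `(ZMod 5)ˣ` is cyclic of order `4`: the elements of order `4` generate. [folklore] -/
private theorem zmod5_units_gen : ∀ δ e : (ZMod 5)ˣ, δ ≠ 1 → e ^ 2 ≠ 1 →
    δ * e = 1 ∨ δ * e * e = 1 ∨ δ * e * e * e = 1 := by decide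

/-- [folklore] -/
private theorem zmod5_two_mul_three : (2 : ZMod 5) * 3 = 1 := by decide

/-- [folklore] -/
private theorem zmod5_sq_two_ne_one : (2 : ZMod 5) ^ 2 ≠ 1 := by decide

/-- `3` is not a square mod `5`. [folklore] -/
private theorem zmod5_no_root : ∀ l : ZMod 5, l ^ 2 - 0 * l + 2 ≠ 0 := by decide

/-- [folklore] -/
private theorem zmod5_sign : ∀ x y : ZMod 5, (x * y) ^ 2 = 1 →
    ∃ c : ZMod 5, (c = 1 ∨ c = -1) ∧ x = c * y ∧ y = c * x := by decide

variable [Fact (Nat.Prime 5)]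

/-- **Caraiani–Newton, Lemma 7.1.1 (3)** (`p = 5`, group-theoretic form). Let `G ⊆ GL₂(𝔽₅)`
fix no line of `𝔽₅²`, let `G ∩ SL₂(𝔽₅)` have a common eigenvector over some extension field
(the hypotheses of `exists_le_normalizer_cartan`), and let `det : G → 𝔽₅ˣ` be **onto** (for
`G = ρ̄(G_F)` with `det ρ̄ = ε̄₅` this is the printed hypothesis `[F(ζ₅) : F] = 4`).  Then `G` is
contained in the normaliser `C_ns⁺(5)` of a **non-split** Cartan subgroup `kˣ`
(`k ⊆ M₂(𝔽₅)` a field of degree `2`).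

Proof.  If `G` is abelian it lies inside a non-split Cartan subgroup
(`exists_le_unitGroup_adjoinElem_of_comm`).  Otherwise take `s ∈ G` non-scalar of determinant
`1` (`exists_det_eq_one_ne_smul_one`), regular semisimple (`disc_ne_zero`), with
`G ⊆ N(𝔽₅[s]ˣ)` (`le_normalizer_unitGroup_adjoinElem_of_det_eq_one`); if `𝔽₅[s]` is a field we
are done, so assume `s` has an eigenvalue in `𝔽₅`: then `tr s = 0`, the eigenvalues are `2, 3`,
and `𝔽₅[s]ˣ = P (* 0; 0 *) P⁻¹` is split (Serre, `exists_unitGroup_adjoinElem_eq_splitCartan`),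
so every `g ∈ G` is diagonal or antidiagonal in the basis `P` (`mem_normalizer_splitCartan_iff`)
— the source's "`G⁺ ⊆ C_s(5)`, `G ⊆ C_s⁺(5)`" situation, treated there by [FLHS15, Prop. 4.1].
Here: (i) antidiagonal elements of `G` have `det ≠ 1` (a determinant-one element commutes
with `s = diag(2, 3)`); (ii) antidiagonal elements exist (irreducibility), hence no diagonal
element `h` of `G` has `det h` of order `4` (some `m hⁱ`, `m` antidiagonal, would have
determinant `1`), i.e. `(det h)² = 1` for diagonal `h ∈ G`; (iii) by surjectivity of `det`
there is `g₀ ∈ G` with `det g₀ = 2`, necessarily antidiagonal, so `tr g₀ = 0`, `g₀² = -2 = 3` is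
a non-square and `k = 𝔽₅[g₀] ≅ 𝔽₂₅`; (iv) a diagonal `h = diag(x, y) ∈ G` has `(xy)² = 1`,
whence `x = ±y` … precisely `x = c y`, `y = c x` with `c = ±1`, so `h g₀ h⁻¹ = c g₀ = ±g₀ ∈
{g₀, ḡ₀}` and `h ∈ N(kˣ)` (Serre, `mem_unitGroup_of_conj_eq`,
`mem_normalizer_unitGroup_of_conj_eq`); an antidiagonal `h ∈ G` is `(h g₀⁻¹) g₀` with `h g₀⁻¹`
diagonal.  (So `G` has index `3` in `N(kˣ)`, loc. cit.; not recorded.)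
[cite: CaraianiNewton2023, Lemma 7.1.1 (3)] -/
theorem exists_le_normalizer_nonsplitCartan (G : Subgroup (GL (Fin 2) (ZMod 5)))
    (hirr : ∀ (v : Fin 2 → ZMod 5) (hv : v ≠ 0), ¬ G ≤ eigenvectorStabilizer v hv)
    (hred : ∃ (L : Type u) (_ : Field L) (f : ZMod 5 →+* L) (v : Fin 2 → L), v ≠ 0 ∧
      ∀ g ∈ G, Matrix.GeneralLinearGroup.det g = 1 → ∃ c : L, ((g : Matrix (Fin 2) (Fin 2) (ZMod 5)).map f) *ᵥ v = c • v)
    (hdet : ∀ u : (ZMod 5)ˣ, ∃ g ∈ G, Matrix.GeneralLinearGroup.det g = u) :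
    ∃ k : Subalgebra (ZMod 5) (Matrix (Fin 2) (Fin 2) (ZMod 5)), IsField k ∧ Module.finrank (ZMod 5) k = 2 ∧
      G ≤ Subgroup.normalizer (Serre1972.unitGroup k : Set (GL (Fin 2) (ZMod 5))) := by
  classical
  by_cases hab : ∀ a b : G, a * b = b * a
  · obtain ⟨y, -, hys, hno, hle⟩ := exists_le_unitGroup_adjoinElem_of_comm G hirr hab
    exact ⟨_, Serre1972.isField_adjoinElem hno, Serre1972.finrank_adjoinElem hys,
      hle.trans Subgroup.le_normalizer⟩
  obtain ⟨s, hsG, hsdet, hss⟩ := exists_det_eq_one_ne_smul_one G hab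
  have hdisc := disc_ne_zero (by decide) G hirr hred hsG hss
  have hGN := le_normalizer_unitGroup_adjoinElem_of_det_eq_one G hirr hred hsG hsdet hss
  by_cases hroot : ∃ l : ZMod 5, l ^ 2 - (s : Matrix (Fin 2) (Fin 2) (ZMod 5)).trace * l + (s : Matrix (Fin 2) (Fin 2) (ZMod 5)).det = 0
  swap
  · push Not at hroot
    exact ⟨_, Serre1972.isField_adjoinElem hroot, Serre1972.finrank_adjoinElem hss, hGN⟩
  /- the split case: `tr s = 0`, `𝔽₅[s]ˣ = P (* 0; 0 *) P⁻¹` -/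
  obtain ⟨l, hl⟩ := hroot
  have hdet1 : (s : Matrix (Fin 2) (Fin 2) (ZMod 5)).det = 1 := by
    rw [← Matrix.GeneralLinearGroup.val_det_apply, hsdet, Units.val_one]
  have htr0 : (s : Matrix (Fin 2) (Fin 2) (ZMod 5)).trace = 0 := by
    exact zmod5_trace_eq_zero _ l (by rwa [hdet1] at hl) (by rwa [hdet1] at hdisc)
  obtain ⟨P, hP⟩ := Serre1972.exists_unitGroup_adjoinElem_eq_splitCartan hdisc hl
  rw [hP] at hGN
  have hF : ∃ u : (ZMod 5)ˣ, u ≠ 1 := Serre1972.exists_units_ne_one (p := 5) (by decide)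
  have hshape : ∀ g ∈ G, GL2.IsDg ((P⁻¹ * g * P : GL (Fin 2) (ZMod 5)) : Matrix (Fin 2) (Fin 2) (ZMod 5)) ∨
      GL2.IsAd ((P⁻¹ * g * P : GL (Fin 2) (ZMod 5)) : Matrix (Fin 2) (Fin 2) (ZMod 5)) := fun g hg ↦
    (Serre1972.mem_normalizer_splitCartan_iff hF).mp (hGN hg)
  -- `D = P⁻¹ s P = diag(a, d)` with `a ≠ d`
  have hsC : s ∈ Serre1972.splitCartan P := by
    rw [← hP]; exact Serre1972.self_mem_adjoinElem (s : Matrix (Fin 2) (Fin 2) (ZMod 5))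
  have hDdg : GL2.IsDg ((P⁻¹ * s * P : GL (Fin 2) (ZMod 5)) : Matrix (Fin 2) (Fin 2) (ZMod 5)) :=
    Serre1972.mem_splitCartan_iff.mp hsC
  set D : Matrix (Fin 2) (Fin 2) (ZMod 5) := ((P⁻¹ * s * P : GL (Fin 2) (ZMod 5)) : Matrix (Fin 2) (Fin 2) (ZMod 5)) with hD
  have had : D 0 0 * D 1 1 = 1 := by rw [← GL2.det_of_isDg hDdg, hD, det_coe_conj, hdet1]
  have hapd : D 0 0 + D 1 1 = 0 := by rw [← Matrix.trace_fin_two, hD, trace_coe_conj, htr0]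
  have hne : D 0 0 ≠ D 1 1 := by
    exact zmod5_ne_of_mul_eq_one _ _ had hapd
  /- (i) antidiagonal elements of `G` have determinant `≠ 1` -/
  have hAd_det : ∀ g ∈ G, GL2.IsAd ((P⁻¹ * g * P : GL (Fin 2) (ZMod 5)) : Matrix (Fin 2) (Fin 2) (ZMod 5)) →
      Matrix.GeneralLinearGroup.det g ≠ 1 := by
    intro g hg hga hg1
    have hc := mul_comm_of_det_eq_one G hirr hred hsG hg hsdet hg1
    have hcm : D * ((P⁻¹ * g * P : GL (Fin 2) (ZMod 5)) : Matrix (Fin 2) (Fin 2) (ZMod 5)) =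
        ((P⁻¹ * g * P : GL (Fin 2) (ZMod 5)) : Matrix (Fin 2) (Fin 2) (ZMod 5)) * D := by
      rw [hD, ← Units.val_mul, ← Units.val_mul, ← conj_mul, hc, conj_mul]
    set X : Matrix (Fin 2) (Fin 2) (ZMod 5) := ((P⁻¹ * g * P : GL (Fin 2) (ZMod 5)) : Matrix (Fin 2) (Fin 2) (ZMod 5)) with hX
    have e01 := congrFun (congrFun hcm 0) 1
    simp only [Matrix.mul_apply, Fin.sum_univ_two, hDdg.1, hga.1, hga.2, mul_zero,
      add_zero, zero_add] at e01
    -- `e01 : D 0 0 * X 0 1 = X 0 1 * D 1 1`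
    have hX01 : X 0 1 ≠ 0 := (hga.entry_ne_zero (GL2.det_ne_zero _)).1
    apply hne
    have : (D 0 0 - D 1 1) * X 0 1 = 0 := by linear_combination e01
    exact sub_eq_zero.mp ((mul_eq_zero.mp this).resolve_right hX01)
  /- (ii) antidiagonal elements exist; diagonal elements have `(det h)² = 1` -/
  have hexAd : ∃ m ∈ G, GL2.IsAd ((P⁻¹ * m * P : GL (Fin 2) (ZMod 5)) : Matrix (Fin 2) (Fin 2) (ZMod 5)) := by
    by_contra! hall
    refine hirr ((P : Matrix (Fin 2) (Fin 2) (ZMod 5)).col 0) (col_zero_ne_zero P) fun g hg ↦ ?_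
    have hgd := (hshape g hg).resolve_right (hall g hg)
    obtain ⟨⟨c, hc⟩, -⟩ :=
      Serre1972.mem_splitCartan_iff_col.mp (Serre1972.mem_splitCartan_iff.mpr hgd)
    exact mem_eigenvectorStabilizer_iff.mpr ⟨c, hc⟩
  have hDg_det : ∀ h ∈ G, GL2.IsDg ((P⁻¹ * h * P : GL (Fin 2) (ZMod 5)) : Matrix (Fin 2) (Fin 2) (ZMod 5)) →
      Matrix.GeneralLinearGroup.det h ^ 2 = 1 := by
    intro h hh hhd
    by_contra hne1
    obtain ⟨m, hm, hma⟩ := hexAd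
    have hδ := hAd_det m hm hma
    have h1a : GL2.IsAd ((P⁻¹ * (m * h) * P : GL (Fin 2) (ZMod 5)) : Matrix (Fin 2) (Fin 2) (ZMod 5)) := by
      rw [conj_mul, Units.val_mul]; exact hma.mul_isDg hhd
    have h2a : GL2.IsAd ((P⁻¹ * (m * h * h) * P : GL (Fin 2) (ZMod 5)) : Matrix (Fin 2) (Fin 2) (ZMod 5)) := by
      rw [conj_mul, Units.val_mul]; exact h1a.mul_isDg hhd
    have h3a : GL2.IsAd ((P⁻¹ * (m * h * h * h) * P : GL (Fin 2) (ZMod 5)) : Matrix (Fin 2) (Fin 2) (ZMod 5)) := by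
      rw [conj_mul, Units.val_mul]; exact h2a.mul_isDg hhd
    rcases zmod5_units_gen _ _ hδ hne1 with e | e | e
    · exact hAd_det _ (G.mul_mem hm hh) h1a (by rw [map_mul, e])
    · exact hAd_det _ (G.mul_mem (G.mul_mem hm hh) hh) h2a (by rw [map_mul, map_mul, e])
    · exact hAd_det _ (G.mul_mem (G.mul_mem (G.mul_mem hm hh) hh) hh) h3a
        (by rw [map_mul, map_mul, map_mul, e])
  /- (iii) an antidiagonal `g₀ ∈ G` of determinant `2`; `k = 𝔽₅[g₀]` is a field -/
  obtain ⟨g₀, hg₀G, hg₀det⟩ := hdet (Units.mkOfMulEqOne (2 : ZMod 5) 3 zmod5_two_mul_three)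
  have hg₀detv : (g₀ : Matrix (Fin 2) (Fin 2) (ZMod 5)).det = 2 := by
    rw [← Matrix.GeneralLinearGroup.val_det_apply, hg₀det, Units.val_mkOfMulEqOne]
  have hg₀a : GL2.IsAd ((P⁻¹ * g₀ * P : GL (Fin 2) (ZMod 5)) : Matrix (Fin 2) (Fin 2) (ZMod 5)) := by
    refine (hshape g₀ hg₀G).resolve_left fun hd ↦ ?_
    have h := hDg_det g₀ hg₀G hd
    rw [hg₀det] at h
    have h' := congrArg Units.val h
    rw [Units.val_pow_eq_pow_val, Units.val_mkOfMulEqOne, Units.val_one] at h'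
    exact zmod5_sq_two_ne_one h'
  set A : Matrix (Fin 2) (Fin 2) (ZMod 5) := ((P⁻¹ * g₀ * P : GL (Fin 2) (ZMod 5)) : Matrix (Fin 2) (Fin 2) (ZMod 5)) with hA
  have hg₀tr : (g₀ : Matrix (Fin 2) (Fin 2) (ZMod 5)).trace = 0 := by
    rw [← trace_coe_conj P g₀, Matrix.trace_fin_two, ← hA, hg₀a.1, hg₀a.2, add_zero]
  have hg₀ns : ∀ c : ZMod 5, (g₀ : Matrix (Fin 2) (Fin 2) (ZMod 5)) ≠ c • 1 := by
    intro c hc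
    have hAc : A = c • 1 := by
      rw [hA, coe_conj_of_eq_smul hc, Matrix.mul_one,
        Matrix.nonsing_inv_mul _ (GL2.det_ne_zero P).isUnit]
    exact hg₀a.not_isDg (hA ▸ GL2.det_ne_zero _) (hAc ▸ GL2.isDg_smul_one c)
  have hno' : ∀ l : ZMod 5, l ^ 2 - (g₀ : Matrix (Fin 2) (Fin 2) (ZMod 5)).trace * l + (g₀ : Matrix (Fin 2) (Fin 2) (ZMod 5)).det ≠ 0 := by
    rw [hg₀tr, hg₀detv]; exact zmod5_no_root
  set k : Subalgebra (ZMod 5) (Matrix (Fin 2) (Fin 2) (ZMod 5)) := Serre1972.adjoinElem (g₀ : Matrix (Fin 2) (Fin 2) (ZMod 5)) with hk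
  have hkf : IsField k := Serre1972.isField_adjoinElem hno'
  have hk2 : Module.finrank (ZMod 5) k = 2 := Serre1972.finrank_adjoinElem hg₀ns
  have hg₀k : (g₀ : Matrix (Fin 2) (Fin 2) (ZMod 5)) ∈ k := Serre1972.self_mem_adjoinElem _
  /- (iv) diagonal elements of `G` conjugate `g₀` to `±g₀` -/
  have hDgN : ∀ h ∈ G, GL2.IsDg ((P⁻¹ * h * P : GL (Fin 2) (ZMod 5)) : Matrix (Fin 2) (Fin 2) (ZMod 5)) →
      h ∈ Subgroup.normalizer (Serre1972.unitGroup k : Set (GL (Fin 2) (ZMod 5))) := by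
    intro h hh hhd
    set X : Matrix (Fin 2) (Fin 2) (ZMod 5) := ((P⁻¹ * h * P : GL (Fin 2) (ZMod 5)) : Matrix (Fin 2) (Fin 2) (ZMod 5)) with hX
    have hxy : (X 0 0 * X 1 1) ^ 2 = 1 := by
      have h1 := hDg_det h hh hhd
      have h2 := congrArg Units.val h1
      rw [Units.val_pow_eq_pow_val, Matrix.GeneralLinearGroup.val_det_apply, Units.val_one,
        ← det_coe_conj P h, ← hX, GL2.det_of_isDg hhd] at h2
      exact h2
    obtain ⟨c, hc, hxc, hyc⟩ := zmod5_sign _ _ hxy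
    -- `X A = c (A X)`, i.e. `h g₀ = c g₀ h`
    have hXA : X * A = c • (A * X) := by
      rw [hhd.eq_diagonal]
      ext i j
      fin_cases i <;> fin_cases j <;>
        simp [Matrix.mul_apply, Matrix.diagonal, hg₀a.1, hg₀a.2]
      · rw [hxc]; ring
      · rw [hyc]; ring
    have hrel : (h : Matrix (Fin 2) (Fin 2) (ZMod 5)) * g₀ = c • ((g₀ : Matrix (Fin 2) (Fin 2) (ZMod 5)) * h) := by
      have hY : ((P⁻¹ * (h * g₀) * P : GL (Fin 2) (ZMod 5)) : Matrix (Fin 2) (Fin 2) (ZMod 5)) =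
          c • ((P⁻¹ * (g₀ * h) * P : GL (Fin 2) (ZMod 5)) : Matrix (Fin 2) (Fin 2) (ZMod 5)) := by
        rw [conj_mul, conj_mul, Units.val_mul (P⁻¹ * h * P) (P⁻¹ * g₀ * P),
          Units.val_mul (P⁻¹ * g₀ * P) (P⁻¹ * h * P), ← hX, ← hA, hXA]
      calc (h : Matrix (Fin 2) (Fin 2) (ZMod 5)) * g₀ = ((h * g₀ : GL (Fin 2) (ZMod 5)) : Matrix (Fin 2) (Fin 2) (ZMod 5)) := (Units.val_mul _ _).symm
        _ = (P : Matrix (Fin 2) (Fin 2) (ZMod 5)) * ((P⁻¹ * (h * g₀) * P : GL (Fin 2) (ZMod 5)) : Matrix (Fin 2) (Fin 2) (ZMod 5)) * (P : Matrix (Fin 2) (Fin 2) (ZMod 5))⁻¹ :=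
            coe_eq_conj_conj P _
        _ = c • ((P : Matrix (Fin 2) (Fin 2) (ZMod 5)) * ((P⁻¹ * (g₀ * h) * P : GL (Fin 2) (ZMod 5)) : Matrix (Fin 2) (Fin 2) (ZMod 5)) * (P : Matrix (Fin 2) (Fin 2) (ZMod 5))⁻¹) := by
            rw [hY, Matrix.mul_smul, Matrix.smul_mul]
        _ = c • ((g₀ * h : GL (Fin 2) (ZMod 5)) : Matrix (Fin 2) (Fin 2) (ZMod 5)) := by rw [← coe_eq_conj_conj P]
        _ = c • ((g₀ : Matrix (Fin 2) (Fin 2) (ZMod 5)) * h) := by rw [Units.val_mul]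
    have hconj : (h : Matrix (Fin 2) (Fin 2) (ZMod 5)) * g₀ * (h : Matrix (Fin 2) (Fin 2) (ZMod 5))⁻¹ = c • (g₀ : Matrix (Fin 2) (Fin 2) (ZMod 5)) := by
      rw [hrel, Matrix.smul_mul, Matrix.mul_nonsing_inv_cancel_right _ _ (GL2.det_ne_zero h).isUnit]
    rcases hc with rfl | rfl
    · rw [one_smul] at hconj
      exact Subgroup.le_normalizer (Serre1972.mem_unitGroup_of_conj_eq hg₀k hg₀ns hconj)
    · refine Serre1972.mem_normalizer_unitGroup_of_conj_eq hk2 hg₀k hg₀ns ?_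
      rw [hconj, hg₀tr, zero_smul, zero_sub, neg_one_smul]
  refine ⟨k, hkf, hk2, fun h hh ↦ ?_⟩
  rcases hshape h hh with hd | ha
  · exact hDgN h hh hd
  · have hinv : GL2.IsAd ((P⁻¹ * g₀⁻¹ * P : GL (Fin 2) (ZMod 5)) : Matrix (Fin 2) (Fin 2) (ZMod 5)) := by
      have : (P⁻¹ * g₀⁻¹ * P : GL (Fin 2) (ZMod 5)) = (P⁻¹ * g₀ * P)⁻¹ := by group
      rw [this, Matrix.coe_units_inv]
      exact hg₀a.inv
    have h1 : GL2.IsDg ((P⁻¹ * (h * g₀⁻¹) * P : GL (Fin 2) (ZMod 5)) : Matrix (Fin 2) (Fin 2) (ZMod 5)) := by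
      rw [conj_mul, Units.val_mul]; exact ha.mul hinv
    have h2 := hDgN _ (G.mul_mem hh (G.inv_mem hg₀G)) h1
    have h3 : g₀ ∈ Subgroup.normalizer (Serre1972.unitGroup k : Set (GL (Fin 2) (ZMod 5))) :=
      Subgroup.le_normalizer (Serre1972.mem_unitGroup_iff.mpr hg₀k)
    have e : h = h * g₀⁻¹ * g₀ := by group
    rw [e]
    exact Subgroup.mul_mem _ h2 h3

end Five

end Literature.NumberTheory.GaloisRepresentations.CaraianiNewton
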